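import Literature.Combinatorics.Optimization.PsdRankComparisons
import Literature.LinearAlgebra.Matrix.RankMinors
import Mathlib.Data.Sym.Card
import HarnessLib

/-!
# FGPRT §7 "Space of factorizations": the space `𝒮ℱ(M)`, counting dimensions, Proposition 7.3's
# constructions, and the worked Examples 7.1, 7.7, 7.8 — PROVED (Fawzi–Gouveia–Parrilo–Robinson–Thomas 2015)

Source: H. Fawzi, J. Gouveia, P. A. Parrilo, R. Z. Robinson, R. R. Thomas, *Positive semidefinite
rank*, Math. Program. Ser. B 153 (2015) 133–177 = arXiv:1407.4095 [FawziEtAl2015], §7 "Space of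
factorizations" (held text `paper:arxiv-1407.4095`, chunks p20–p22; arXiv numbering). Vocabulary: the
tree's `HasPsdFactorization M k` ("`rank_psd(M) ≤ k`") and `derangementMatrix` (`PsdRankComparisons.lean`,
with Example 5.1 `FawziEtAl2015_ex51_holds` and `rank_derangementMatrix`), `Matrix.rank`, and the
rank-by-minors lemma `Literature.LinearAlgebra.Matrix.card_le_rank_of_det_submatrix_ne_zero`.

§7 studies, for a nonnegative `M` of psd rank `k`, the set `𝒮ℱ(M)` of all its size-`k` psd
factorizations `(A_1,…,A_p,B_1,…,B_q)` and the `GL(k)`-action `(Lᵀ A_i L, L⁻¹ B_j L⁻ᵀ)` (p20: "We refer to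
the set of all such psd factorizations as the orbit"). This file PROVES the §7 warm-up facts about
`𝒮ℱ(M)`, the "count dimensions" step, the two constructions of Proposition 7.3 (`𝒮ℱ(M) ⇄ Δ_k(P,Q)`)
with their well-definedness and inverse relationship, and the concrete assertions of the three worked
examples. NOT typed: the topological packaging of Proposition 7.3 ("homeomorphic": continuity of the
two maps), Corollary 7.4 (the quotients by `GL(k)`), Example 7.5 / Remark 7.6, and Proposition 7.9
(connectedness for `k = 2`).

* **The space `𝒮ℱ(M)`** (p20): `psdFactorizationSpace M k ⊆ (S^k)^p × (S^k)^q` (the survey's `𝒮ℱ(M)` is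
  the case `k = rank_psd M`; nonempty iff `rank_psd M ≤ k`, `psdFactorizationSpace_nonempty_iff`), with
  the three warm-up assertions of p20 PROVED: the `GL(k)`-orbit "for any psd factorization … and any
  `L ∈ GL(k)`, the matrices `(Lᵀ A_1 L,…,L⁻¹ B_q L⁻ᵀ)` also form a psd factorization of `M`"
  (`conj_mem_psdFactorizationSpace`), "`𝒮ℱ(M)` is closed" (`isClosed_psdFactorizationSpace`) "and
  infinite" (`psdFactorizationSpace_infinite`: as soon as one factorization with some `A_i ≠ 0` exists,
  via the orbit of `L = cI`).
* **Counting dimensions** (p20: "we can count dimensions to see that the map `π` is invertible and the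
  subspace `L` is all of `S^k`"; proof of Prop. 7.3, p21: "The set `(A_1,…,A_p)` spans `S^k` (else we
  could find a lower dimensional rank factorization of `M`)"): for ANY factorization `M_{ij} = ⟨A_i,B_j⟩`
  through `k × k` matrices, `rank M ≤ dim span{A_i}` and `rank M ≤ dim span{B_j}`
  (`rank_le_finrank_span_rowFactors` / `_colFactors`: the rows of `M` are the images of the `A_i` under
  `X ↦ (⟨X,B_j⟩)_j`), symmetric factors span `≤ C(k+1,2)` dimensions
  (`finrank_span_le_choose_of_isSymm`), hence when `rank M = C(k+1,2)` the `A_i`, and the `B_j`, span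
  ALL of `S^k` (`FawziEtAl2015_sec7_rowFactors_span`, `_colFactors_span`, `_psdFactors_span`; instance:
  the factors of Example 7.7 span `S^2`, `FawziEtAl2015_ex77_factors_span`).
* **Proposition 7.3** (p20–p21): for a rank factorization `M = U V` (inner dimension `r = rank M =
  C(k+1,2)`; rows `u_i` of `U`, columns `v_j` of `V`; `P = cone(u_i)`, `Q = {x | v_jᵀx ≥ 0}`), the space
  `Δ_k(P,Q)` of linear `π` with `P ⊆ π(S^k_+) ⊆ Q` is `IsNestedConeMap U V k π` (typed for `π` defined on
  all `k × k` matrices, only its values on `S^k` being relevant; `IsNestedConeMap.cone_subset`). PROVED: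
  the map `𝒮ℱ(M) → Δ_k(P,Q)` ("define `π` by `π(A_i) = u_i` … `⟨π(L), v_j⟩ = ⟨L, B_j⟩`",
  `FawziEtAl2015_prop73_forward`; hence "`Δ_k(P,Q)` is nonempty", `FawziEtAl2015_sec7_delta_nonempty`),
  its well-definedness (`FawziEtAl2015_prop73_unique`: two such `π` agree on `S^k`), the map
  `Δ_k(P,Q) → 𝒮ℱ(M)` ("`A_i = π⁻¹(u_i)`, `B_j = π^*(v_j)`", `FawziEtAl2015_prop73_backward`, which needs
  no rank hypothesis), and "This map is the inverse of the one defined above"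
  (`FawziEtAl2015_prop73_inverse`: `π` is injective on `S^k` by counting dimensions, and a symmetric
  matrix is determined by its pairings with `S^k`). The word "homeomorphic" (continuity) is not typed.
* **Example 7.1** (p20, verbatim): "Let `M` be the `3 × 3` derangement matrix … This matrix has usual rank
  three and psd rank two as shown by the factorization `[[1,0],[0,0]], [[0,0],[0,1]], [[1,−1],[−1,1]],
  [[0,0],[0,1]], [[1,0],[0,0]], [[1,1],[1,1]]`. Let `𝒳` denote an arbitrary psd factorization of `M`. The
  zero pattern of `M` implies that the matrices composing `𝒳` must all be rank one. Now it is
  straightforward to see that there exists an invertible matrix such that conjugation by this matrix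
  will send `𝒳` to the explicit factorization above. Hence, `𝒮ℱ(M)` is composed of a single orbit."
  Here: `FawziEtAl2015_ex71_factorization` / `_psdRank` (the displayed factorization, `rank_psd D₃ = 2`,
  `rank D₃ = 3`), `FawziEtAl2015_ex71_rankOne` (every size-2 factorization consists of `a_i a_iᵀ`,
  `b_j b_jᵀ` with nonzero vectors, `⟨a_i,b_i⟩ = 0`, `⟨a_i,b_j⟩² = 1`; via Prop. 2.1 `⟨A,B⟩ = 0 ⇒ AB = 0`),
  and `FawziEtAl2015_ex71_singleOrbit` (explicit `L = P⁻¹ diag(1,σ)`, `L⁻¹ = diag(1,σ) P` with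
  `P = [a₀ᵀ; a₁ᵀ]`, `σ = ⟨a₀,b₂⟩⟨a₁,b₂⟩ = ±1`, conjugating ANY size-2 factorization to the displayed one).
* **Example 7.7** (p21–p22): the rank-three matrix `M = [[3,3,1,1],[1,3,3,1],[1,1,3,3],[3,1,1,3]]`
  with its printed rank factorization `U V` (`ex77Matrix_eq_mul`, `rank_ex77Matrix`), and BOTH displayed
  size-2 psd factorizations checked entrywise: the "circle of radius `√2`" one with `α = 1/√2`
  (`FawziEtAl2015_ex77_circle`) and the rational "ellipse with horizontal axis four and vertical axis
  three" one (`FawziEtAl2015_ex77`; hence `rank_psd M = 2`).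
* **Example 7.8** (p22, verbatim): "we present a `4 × 4` matrix with psd rank two such that every `2 × 2`
  psd factorization must have a rank two matrix on a row and a rank two matrix on a column":
  `M = [[0,1,1,2],[1,0,1,2],[1,1,0,6],[1,1,3,3]] = U V` (`ex78Matrix_eq_mul`, `rank_ex78Matrix = 3`), the
  printed factorization (the `D₃` one bordered by `[[1,½],[½,1]]` and `[[2,−1],[−1,2]]`;
  `FawziEtAl2015_ex78_factorization`, hence `rank_psd M = 2`), and the assertion itself
  `FawziEtAl2015_ex78_rankTwo`: in EVERY size-2 psd factorization the last row factor and the last column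
  factor are nonsingular. The printed argument is geometric (the unique circle nested between the two
  triangles of Remark 7.6 does not touch the new vertex / facet); the proof here is algebraic and
  self-contained: by Example 7.1 the `D₃` block is `a_i a_iᵀ, b_j b_jᵀ`; `{b₀,b₁}` is a basis of `ℝ²`
  (Lagrange identity) and `b₂ = γb₀ + δb₁` with `γ² = δ² = 1`, so a singular `A₃ = ccᵀ` would give
  `⟨c,b₂⟩ = ±1 ± 1`, contradicting `⟨c,b₂⟩² = M₃₂ = 3 ∉ {0,4}`; dually a singular `B₃ = ddᵀ` would give
  `⟨a₂,d⟩² ∈ {0, 8} ∌ 6`. Appended: the sentence "the space of factorizations consists of a single orbit"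
  itself (`FawziEtAl2015_ex78_singleOrbit`): every size-2 psd factorization of `M` is conjugate to the
  displayed one — Example 7.1's single orbit on the `D₃` block, after which the bordering factors are
  forced by their three pairings with the displayed rank-one factors.

Two definitions (`psdFactorizationSpace`, the survey's `𝒮ℱ(M)` with the size as a parameter, and the
predicate `IsNestedConeMap`, membership in `Δ_k(P,Q)`), no named facts; all other statements are theorems about explicit matrices, about all size-2 psd factorizations
of them, or about all factorizations through `k × k` matrices.
-/

noncomputable section

open Matrix Finset
open scoped MatrixOrder

namespace Literature.Combinatorics.Optimization

/-! ### `2 × 2` tools -/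

section TwoByTwo

/-- `Tr(a aᵀ · b bᵀ) = ⟨a, b⟩²`. [folklore] -/
private theorem trace_vecMulVec_mul_vecMulVec {k : ℕ} (a b : Fin k → ℝ) :
    (vecMulVec a a * vecMulVec b b).trace = (a ⬝ᵥ b) ^ 2 := by
  rw [vecMulVec_mul_vecMulVec, trace_vecMulVec, dotProduct_smul, smul_eq_mul, sq]

/-- A singular real psd `2 × 2` matrix is `v vᵀ`. [folklore] -/
private theorem exists_eq_vecMulVec_of_det_eq_zero {A : Matrix (Fin 2) (Fin 2) ℝ}
    (hA : A.PosSemidef) (hdet : A.det = 0) : ∃ v : Fin 2 → ℝ, A = vecMulVec v v := by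
  have hsymm : A 1 0 = A 0 1 := by simpa using hA.1.apply 0 1
  have h00 : 0 ≤ A 0 0 := hA.diag_nonneg
  have h11 : 0 ≤ A 1 1 := hA.diag_nonneg
  rw [Matrix.det_fin_two, hsymm] at hdet
  by_cases h0 : A 0 0 = 0
  · have h01 : A 0 1 = 0 := by
      have : A 0 1 * A 0 1 = 0 := by nlinarith
      exact mul_self_eq_zero.mp this
    refine ⟨![0, Real.sqrt (A 1 1)], ?_⟩
    ext i j
    fin_cases i <;> fin_cases j <;>
      simp [vecMulVec_apply, h0, h01, hsymm, Real.mul_self_sqrt h11]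
  · have hpos : 0 < A 0 0 := lt_of_le_of_ne h00 (Ne.symm h0)
    have hs : Real.sqrt (A 0 0) ≠ 0 := (Real.sqrt_pos.mpr hpos).ne'
    refine ⟨![Real.sqrt (A 0 0), A 0 1 / Real.sqrt (A 0 0)], ?_⟩
    ext i j
    fin_cases i <;> fin_cases j
    · simp [vecMulVec_apply, Real.mul_self_sqrt h00]
    · simp [vecMulVec_apply]
      field_simp
    · simp [vecMulVec_apply, hsymm]
      field_simp
    · simp [vecMulVec_apply]
      field_simp
      rw [Real.sq_sqrt h00]
      linarith

/-- `A B = 0` with `B ≠ 0` forces `det A = 0`. [folklore] -/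
private theorem det_eq_zero_of_mul_eq_zero {A B : Matrix (Fin 2) (Fin 2) ℝ} (h : A * B = 0)
    (hB : B ≠ 0) : A.det = 0 := by
  by_contra hdet
  apply hB
  calc B = A⁻¹ * (A * B) := by
        rw [← Matrix.mul_assoc, Matrix.nonsing_inv_mul A (isUnit_iff_ne_zero.mpr hdet), Matrix.one_mul]
    _ = 0 := by rw [h, Matrix.mul_zero]

/-- `A B = 0` with `A ≠ 0` forces `det B = 0`. [folklore] -/
private theorem det_eq_zero_of_mul_eq_zero' {A B : Matrix (Fin 2) (Fin 2) ℝ} (h : A * B = 0)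
    (hA : A ≠ 0) : B.det = 0 := by
  have h' : Bᵀ * Aᵀ = 0 := by rw [← Matrix.transpose_mul, h, Matrix.transpose_zero]
  have := det_eq_zero_of_mul_eq_zero h' (fun hAt => hA (by simpa using congrArg Matrix.transpose hAt))
  rwa [Matrix.det_transpose] at this

/-- Coordinates in a basis of `ℝ²` (Cramer): if `det[b₀ b₁] ≠ 0` then `w = γ b₀ + δ b₁`. [folklore] -/
private theorem exists_coords_fin_two (b₀ b₁ w : Fin 2 → ℝ) (h : b₀ 0 * b₁ 1 - b₀ 1 * b₁ 0 ≠ 0) :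
    ∃ γ δ : ℝ, w = γ • b₀ + δ • b₁ := by
  refine ⟨(w 0 * b₁ 1 - w 1 * b₁ 0) / (b₀ 0 * b₁ 1 - b₀ 1 * b₁ 0),
    (b₀ 0 * w 1 - b₀ 1 * w 0) / (b₀ 0 * b₁ 1 - b₀ 1 * b₁ 0), ?_⟩
  ext i
  fin_cases i
  · simp only [Fin.zero_eta, Fin.isValue, Pi.add_apply, Pi.smul_apply, smul_eq_mul]
    rw [div_mul_eq_mul_div, div_mul_eq_mul_div, ← add_div, eq_div_iff h]
    ring
  · simp only [Fin.mk_one, Fin.isValue, Pi.add_apply, Pi.smul_apply, smul_eq_mul]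
    rw [div_mul_eq_mul_div, div_mul_eq_mul_div, ← add_div, eq_div_iff h]
    ring

/-- Dot products in `ℝ²`. [folklore] -/
private theorem dotProduct_fin_two (x y : Fin 2 → ℝ) : x ⬝ᵥ y = x 0 * y 0 + x 1 * y 1 := by
  simp [dotProduct, Fin.sum_univ_two]


/-- A symmetric `2 × 2` real matrix `[[p,q],[q,r]]` with `p, r ≥ 0` and `q² ≤ pr` is psd. [folklore] -/
private theorem posSemidef_fin_two {p q r : ℝ} (hp : 0 ≤ p) (hr : 0 ≤ r) (hq : q ^ 2 ≤ p * r) :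
    (!![p, q; q, r] : Matrix (Fin 2) (Fin 2) ℝ).PosSemidef := by
  refine PosSemidef.of_dotProduct_mulVec_nonneg ?_ fun x => ?_
  · ext i j
    fin_cases i <;> fin_cases j <;> simp
  · have hform : star x ⬝ᵥ (!![p, q; q, r] *ᵥ x) = p * x 0 ^ 2 + 2 * q * x 0 * x 1 + r * x 1 ^ 2 := by
      simp [Matrix.mulVec, dotProduct, Fin.sum_univ_two]
      ring
    rw [hform]
    by_cases hp0 : p = 0
    · have hq0 : q = 0 := by
        have : q ^ 2 ≤ 0 := by simpa [hp0] using hq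
        exact pow_eq_zero_iff (n := 2) (by norm_num) |>.mp (le_antisymm this (sq_nonneg q))
      rw [hp0, hq0]
      nlinarith [sq_nonneg (x 1)]
    · have hpos : 0 < p := lt_of_le_of_ne hp (Ne.symm hp0)
      have key : p * (p * x 0 ^ 2 + 2 * q * x 0 * x 1 + r * x 1 ^ 2) =
          (p * x 0 + q * x 1) ^ 2 + (p * r - q ^ 2) * x 1 ^ 2 := by ring
      have hnn : 0 ≤ p * (p * x 0 ^ 2 + 2 * q * x 0 * x 1 + r * x 1 ^ 2) := by
        rw [key]
        nlinarith [sq_nonneg (p * x 0 + q * x 1), sq_nonneg (x 1)]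
      exact nonneg_of_mul_nonneg_right hnn hpos

/-- The arithmetic contradiction of Example 7.8: `x² = y² = s` and `(x + y)² = t` force `t = 0` or
`t = 4s`. [folklore] -/
private theorem sq_add_sq_cases {x y s t : ℝ} (hx : x ^ 2 = s) (hy : y ^ 2 = s)
    (h : (x + y) ^ 2 = t) : t = 0 ∨ t = 4 * s := by
  have hxy : 2 * (x * y) = t - 2 * s := by nlinarith
  have hsq : (x * y) ^ 2 = s ^ 2 := by rw [mul_pow, hx, hy, sq]
  have ht : t * (t - 4 * s) = 0 := by nlinarith
  rcases mul_eq_zero.mp ht with h0 | h4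
  · exact Or.inl h0
  · exact Or.inr (by linarith)

/-- In `ℝ²`: if `a ⊥ b₀`, `b₀ ≠ 0` and `⟨a, b₁⟩ ≠ 0` then `b₀, b₁` are linearly independent
(`det[b₀ b₁] ≠ 0`), by the Lagrange identity `⟨a,b₁⟩|b₀|² − ⟨a,b₀⟩⟨b₀,b₁⟩ = (a × b₀)(b₁ × b₀)`.
[folklore] -/
private theorem det_ne_zero_of_orth {a b₀ b₁ : Fin 2 → ℝ} (horth : a ⬝ᵥ b₀ = 0) (hb₀ : b₀ ≠ 0)
    (hab₁ : a ⬝ᵥ b₁ ≠ 0) : b₀ 0 * b₁ 1 - b₀ 1 * b₁ 0 ≠ 0 := by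
  intro hD
  rw [dotProduct_fin_two] at horth hab₁
  have hnorm : 0 < b₀ 0 ^ 2 + b₀ 1 ^ 2 := by
    by_contra hle
    have h0 : b₀ 0 = 0 := by nlinarith [sq_nonneg (b₀ 0), sq_nonneg (b₀ 1)]
    have h1 : b₀ 1 = 0 := by nlinarith [sq_nonneg (b₀ 0), sq_nonneg (b₀ 1)]
    exact hb₀ (by ext i; fin_cases i <;> simp [h0, h1])
  have key : (a 0 * b₁ 0 + a 1 * b₁ 1) * (b₀ 0 ^ 2 + b₀ 1 ^ 2) =
      (a 0 * b₀ 0 + a 1 * b₀ 1) * (b₀ 0 * b₁ 0 + b₀ 1 * b₁ 1) +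
        (a 0 * b₀ 1 - a 1 * b₀ 0) * (b₁ 0 * b₀ 1 - b₁ 1 * b₀ 0) := by ring
  rw [horth, zero_mul, zero_add, show b₁ 0 * b₀ 1 - b₁ 1 * b₀ 0 = -(b₀ 0 * b₁ 1 - b₀ 1 * b₁ 0) by ring,
    hD, neg_zero, mul_zero] at key
  exact hab₁ ((mul_eq_zero.mp key).resolve_right hnorm.ne')

end TwoByTwo

/-! ### Example 7.1: the `3 × 3` derangement matrix -/

section Example71

/-- The printed factorization of `D₃` (p20): `A = (e₁e₁ᵀ, e₂e₂ᵀ, (1,−1)(1,−1)ᵀ)`,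
`B = (e₂e₂ᵀ, e₁e₁ᵀ, (1,1)(1,1)ᵀ)`, as vectors. [cite: FawziEtAl2015, Ex. 7.1 (p20)] -/
def ex71RowVec : Fin 3 → Fin 2 → ℝ := ![![1, 0], ![0, 1], ![1, -1]]

/-- The column vectors of the printed factorization of `D₃`. [cite: FawziEtAl2015, Ex. 7.1 (p20)] -/
def ex71ColVec : Fin 3 → Fin 2 → ℝ := ![![0, 1], ![1, 0], ![1, 1]]

/-- **FGPRT Example 7.1, the displayed factorization** (p20, verbatim): "This matrix has usual rank three
and psd rank two as shown by the factorization `[[1,0],[0,0]], [[0,0],[0,1]], [[1,−1],[−1,1]],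
[[0,0],[0,1]], [[1,0],[0,0]], [[1,1],[1,1]]`." Checked: `⟨a_i a_iᵀ, b_j b_jᵀ⟩ = ⟨a_i,b_j⟩² = D₃(i,j)`.
[cite: FawziEtAl2015, Ex. 7.1 (p20)] -/
theorem FawziEtAl2015_ex71_factorization (i j : Fin 3) :
    derangementMatrix 3 i j =
      (vecMulVec (ex71RowVec i) (ex71RowVec i) * vecMulVec (ex71ColVec j) (ex71ColVec j)).trace := by
  rw [trace_vecMulVec_mul_vecMulVec, dotProduct_fin_two, derangementMatrix_apply]
  fin_cases i <;> fin_cases j <;> simp [ex71RowVec, ex71ColVec]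

/-- `rank_psd(D₃) ≤ 2` by the printed factorization, and `rank D₃ = 3`.
[cite: FawziEtAl2015, Ex. 7.1 (p20)] -/
theorem FawziEtAl2015_ex71_psdRank :
    HasPsdFactorization (derangementMatrix 3) 2 ∧ ¬ HasPsdFactorization (derangementMatrix 3) 1 ∧
      (derangementMatrix 3).rank = 3 := by
  refine ⟨⟨fun i => vecMulVec (ex71RowVec i) (ex71RowVec i),
    fun j => vecMulVec (ex71ColVec j) (ex71ColVec j),
    fun i => by simpa using posSemidef_vecMulVec_self_star (ex71RowVec i),
    fun j => by simpa using posSemidef_vecMulVec_self_star (ex71ColVec j),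
    FawziEtAl2015_ex71_factorization⟩, fun h => ?_, rank_derangementMatrix (by norm_num)⟩
  have := (FawziEtAl2015_ex51_holds 3 1 le_rfl).mp h
  norm_num [Nat.choose] at this

/-- **FGPRT Example 7.1, rank-one factors** (p20, verbatim): "Let `𝒳` denote an arbitrary psd
factorization of `M` [`= D₃`, of size `2`]. The zero pattern of `M` implies that the matrices composing
`𝒳` must all be rank one." Proof: `⟨A_i, B_i⟩ = 0` gives `A_i B_i = 0` (Prop. 2.1) with `A_i, B_i ≠ 0`
(`⟨A_i, B_j⟩ = 1`), so both are singular nonzero psd `2 × 2` matrices, i.e. `A_i = a_i a_iᵀ`,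
`B_j = b_j b_jᵀ` with nonzero vectors; then `⟨a_i, b_i⟩ = 0` and `⟨a_i, b_j⟩² = 1` for `i ≠ j`.
[cite: FawziEtAl2015, Ex. 7.1 (p20)] -/
theorem FawziEtAl2015_ex71_rankOne (A B : Fin 3 → Matrix (Fin 2) (Fin 2) ℝ)
    (hA : ∀ i, (A i).PosSemidef) (hB : ∀ j, (B j).PosSemidef)
    (hM : ∀ i j, derangementMatrix 3 i j = (A i * B j).trace) :
    ∃ a b : Fin 3 → Fin 2 → ℝ, (∀ i, A i = vecMulVec (a i) (a i) ∧ a i ≠ 0) ∧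
      (∀ j, B j = vecMulVec (b j) (b j) ∧ b j ≠ 0) ∧
      (∀ i, a i ⬝ᵥ b i = 0) ∧ (∀ i j, i ≠ j → (a i ⬝ᵥ b j) ^ 2 = 1) := by
  -- nonvanishing and orthogonality from the pattern
  have hzero : ∀ i, A i * B i = 0 := fun i =>
    mul_eq_zero_of_posSemidef_trace_eq_zero (hA i) (hB i) (by rw [← hM]; simp)
  have hone : ∀ i j, i ≠ j → (A i * B j).trace = 1 := fun i j h => by rw [← hM]; simp [h]
  have hother : ∀ i : Fin 3, ∃ j : Fin 3, i ≠ j := fun i => by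
    fin_cases i
    · exact ⟨1, by decide⟩
    · exact ⟨0, by decide⟩
    · exact ⟨0, by decide⟩
  have hAne : ∀ i, A i ≠ 0 := fun i h => by
    obtain ⟨j, hj⟩ := hother i
    have := hone i j hj
    rw [h, Matrix.zero_mul, trace_zero] at this
    exact zero_ne_one this
  have hBne : ∀ j, B j ≠ 0 := fun j h => by
    obtain ⟨i, hi⟩ := hother j
    have := hone i j (Ne.symm hi)
    rw [h, Matrix.mul_zero, trace_zero] at this
    exact zero_ne_one this
  have hdetA : ∀ i, (A i).det = 0 := fun i => det_eq_zero_of_mul_eq_zero (hzero i) (hBne i)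
  have hdetB : ∀ j, (B j).det = 0 := fun j => det_eq_zero_of_mul_eq_zero' (hzero j) (hAne j)
  choose a ha using fun i => exists_eq_vecMulVec_of_det_eq_zero (hA i) (hdetA i)
  choose b hb using fun j => exists_eq_vecMulVec_of_det_eq_zero (hB j) (hdetB j)
  have htr : ∀ i j, (A i * B j).trace = (a i ⬝ᵥ b j) ^ 2 := fun i j => by
    rw [ha i, hb j, trace_vecMulVec_mul_vecMulVec]
  refine ⟨a, b, fun i => ⟨ha i, fun h => hAne i (by rw [ha i, h]; simp)⟩,
    fun j => ⟨hb j, fun h => hBne j (by rw [hb j, h]; simp)⟩, fun i => ?_, fun i j hij => ?_⟩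
  · have := congrArg Matrix.trace (hzero i)
    rw [htr, trace_zero] at this
    exact pow_eq_zero_iff (n := 2) (by norm_num) |>.mp this
  · rw [← htr, hone i j hij]

/-- **FGPRT Example 7.1, single orbit** (p20, verbatim): "Now it is straightforward to see that there
exists an invertible matrix such that conjugation by this matrix will send `𝒳` to the explicit
factorization above. Hence, `𝒮ℱ(M)` is composed of a single orbit." (The orbit of `(A_i, B_j)` is
`(Lᵀ A_i L, L⁻¹ B_j L⁻ᵀ)`, `L ∈ GL(k)`, p20.) Typed: for every size-`2` psd factorization `(A_i, B_j)` of
`D₃` there are `L` and `L' = L⁻¹` (`L L' = I`) with `Lᵀ A_i L = A⁰_i` and `L' B_j L'ᵀ = B⁰_j`, the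
displayed factorization. Construction: `A_i = a_i a_iᵀ`, `B_j = b_j b_jᵀ` (rank one); `P = [a₀ᵀ; a₁ᵀ]`
is invertible; `L = P⁻¹ S`, `L' = S P` with `S = diag(1, σ)`, `σ = ⟨a₀,b₂⟩⟨a₁,b₂⟩ = ±1` the sign that
turns `Pa_2`-coordinates `(±1, ±1)` into `(1, −1)`. [cite: FawziEtAl2015, Ex. 7.1 (p20)] -/
theorem FawziEtAl2015_ex71_singleOrbit (A B : Fin 3 → Matrix (Fin 2) (Fin 2) ℝ)
    (hA : ∀ i, (A i).PosSemidef) (hB : ∀ j, (B j).PosSemidef)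
    (hM : ∀ i j, derangementMatrix 3 i j = (A i * B j).trace) :
    ∃ L L' : Matrix (Fin 2) (Fin 2) ℝ, L * L' = 1 ∧
      ∀ i, Lᵀ * A i * L = vecMulVec (ex71RowVec i) (ex71RowVec i) ∧
        L' * B i * L'ᵀ = vecMulVec (ex71ColVec i) (ex71ColVec i) := by
  obtain ⟨a, b, ha, hb, horth, hone⟩ := FawziEtAl2015_ex71_rankOne A B hA hB hM
  have h01 : (a 0 ⬝ᵥ b 1) ^ 2 = 1 := hone 0 1 (by decide)
  have h10 : (a 1 ⬝ᵥ b 0) ^ 2 = 1 := hone 1 0 (by decide)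
  have h02 : (a 0 ⬝ᵥ b 2) ^ 2 = 1 := hone 0 2 (by decide)
  have h12 : (a 1 ⬝ᵥ b 2) ^ 2 = 1 := hone 1 2 (by decide)
  have h20 : (a 2 ⬝ᵥ b 0) ^ 2 = 1 := hone 2 0 (by decide)
  have h21 : (a 2 ⬝ᵥ b 1) ^ 2 = 1 := hone 2 1 (by decide)
  -- `P = [a₀ᵀ; a₁ᵀ]` and `Q = P⁻¹`
  set P : Matrix (Fin 2) (Fin 2) ℝ := !![a 0 0, a 0 1; a 1 0, a 1 1] with hP
  have hPdet : P.det ≠ 0 := by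
    have horth' : b 0 ⬝ᵥ a 0 = 0 := by rw [dotProduct_comm]; exact horth 0
    have h := det_ne_zero_of_orth horth' (ha 0).2 (fun h => by
      rw [dotProduct_comm] at h; rw [h] at h10; norm_num at h10)
    rw [Matrix.det_fin_two]
    simpa [P] using h
  set Q : Matrix (Fin 2) (Fin 2) ℝ := P⁻¹ with hQ
  have hPQ : P * Q = 1 := Matrix.mul_nonsing_inv P (isUnit_iff_ne_zero.mpr hPdet)
  have hQP : Q * P = 1 := Matrix.nonsing_inv_mul P (isUnit_iff_ne_zero.mpr hPdet)
  have hPv : ∀ v : Fin 2 → ℝ, P *ᵥ v = ![a 0 ⬝ᵥ v, a 1 ⬝ᵥ v] := fun v => by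
    ext i
    fin_cases i
    · simp [P, Matrix.mulVec, Matrix.vecHead, Matrix.vecTail]
    · simp [P, Matrix.mulVec, Matrix.vecHead, Matrix.vecTail]
  have hrowQ0 : ∀ j : Fin 2, (a 0 ᵥ* Q) j = (P * Q) 0 j := fun j => by
    simp [P, Matrix.vecMul, Matrix.mul_apply, dotProduct, Fin.sum_univ_two]
  have hrowQ1 : ∀ j : Fin 2, (a 1 ᵥ* Q) j = (P * Q) 1 j := fun j => by
    simp [P, Matrix.vecMul, Matrix.mul_apply, dotProduct, Fin.sum_univ_two]
  have hrow0 : a 0 ᵥ* Q = ![1, 0] := by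
    ext j
    rw [hrowQ0 j, hPQ]
    fin_cases j <;> simp [Matrix.one_apply]
  have hrow1 : a 1 ᵥ* Q = ![0, 1] := by
    ext j
    rw [hrowQ1 j, hPQ]
    fin_cases j <;> simp [Matrix.one_apply]
  -- coordinates of `a₂` in the basis `a₀, a₁`
  set w : Fin 2 → ℝ := a 2 ᵥ* Q with hw
  have ha2 : a 2 = w ᵥ* P := by rw [hw, Matrix.vecMul_vecMul, hQP, Matrix.vecMul_one]
  have hdot2 : ∀ z : Fin 2 → ℝ, a 2 ⬝ᵥ z = w 0 * (a 0 ⬝ᵥ z) + w 1 * (a 1 ⬝ᵥ z) := fun z => by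
    rw [ha2, ← Matrix.dotProduct_mulVec, hPv, dotProduct_fin_two]
    simp
  have hy2 : w 1 ^ 2 = 1 := by
    have h := h20
    rw [hdot2, horth 0, mul_zero, zero_add, mul_pow, h10, mul_one] at h
    exact h
  have hx2 : w 0 ^ 2 = 1 := by
    have h := h21
    rw [hdot2, horth 1, mul_zero, add_zero, mul_pow, h01, mul_one] at h
    exact h
  have hxuyv : w 0 * (a 0 ⬝ᵥ b 2) + w 1 * (a 1 ⬝ᵥ b 2) = 0 := by
    have h := horth 2
    rw [hdot2] at h
    exact h
  -- the sign `σ = ⟨a₀,b₂⟩⟨a₁,b₂⟩`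
  set σ : ℝ := (a 0 ⬝ᵥ b 2) * (a 1 ⬝ᵥ b 2) with hσ
  have hσ2 : σ * σ = 1 := by
    have : σ * σ = (a 0 ⬝ᵥ b 2) ^ 2 * (a 1 ⬝ᵥ b 2) ^ 2 := by rw [hσ]; ring
    rw [this, h02, h12, one_mul]
  have hσxy : σ * (w 0 * w 1) = -1 := by
    have h1 : w 0 * (a 0 ⬝ᵥ b 2) = -(w 1 * (a 1 ⬝ᵥ b 2)) := by linarith
    calc σ * (w 0 * w 1) = (w 0 * (a 0 ⬝ᵥ b 2)) * (w 1 * (a 1 ⬝ᵥ b 2)) := by rw [hσ]; ring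
      _ = -(w 1 ^ 2 * (a 1 ⬝ᵥ b 2) ^ 2) := by rw [h1]; ring
      _ = -1 := by rw [hy2, h12]; norm_num
  -- the sign matrix and the conjugating pair
  set S : Matrix (Fin 2) (Fin 2) ℝ := !![1, 0; 0, σ] with hS
  have hSS : S * S = 1 := by
    ext i j
    fin_cases i <;> fin_cases j <;> simp [S, Matrix.mul_apply, Fin.sum_univ_two, hσ2]
  have hST : Sᵀ = S := by
    ext i j
    fin_cases i <;> fin_cases j <;> simp [S]
  have hSv : ∀ z : Fin 2 → ℝ, S *ᵥ z = ![z 0, σ * z 1] := fun z => by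
    ext i
    fin_cases i
    · simp [S, Matrix.mulVec, Matrix.vecHead, Matrix.vecTail]
    · simp [S, Matrix.mulVec, Matrix.vecHead, Matrix.vecTail]
  have hvS : ∀ z : Fin 2 → ℝ, z ᵥ* S = ![z 0, σ * z 1] := fun z => by
    rw [← Matrix.mulVec_transpose, hST, hSv]
  -- the target outer products, with the scalars generalized
  have keyR0 : vecMulVec ![(1 : ℝ), σ * 0] ![(1 : ℝ), σ * 0] = vecMulVec (ex71RowVec 0) (ex71RowVec 0) := by
    ext p q
    fin_cases p <;> fin_cases q <;> simp [vecMulVec_apply, ex71RowVec]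
  have keyR1 : ∀ t : ℝ, t * t = 1 →
      vecMulVec ![(0 : ℝ), t * 1] ![(0 : ℝ), t * 1] = vecMulVec (ex71RowVec 1) (ex71RowVec 1) := by
    intro t ht
    ext p q
    fin_cases p <;> fin_cases q <;> simp [vecMulVec_apply, ex71RowVec, ht]
  have keyR2 : ∀ p q : ℝ, p * p = 1 → q * q = 1 → p * q = -1 →
      vecMulVec ![p, q] ![p, q] = vecMulVec (ex71RowVec 2) (ex71RowVec 2) := by
    intro p q hp hq hpq
    have hqp : q * p = -1 := by rw [mul_comm]; exact hpq
    ext i j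
    fin_cases i <;> fin_cases j <;> simp [vecMulVec_apply, ex71RowVec, hp, hq, hpq, hqp]
  have keyC0 : ∀ t : ℝ, t * t = 1 →
      vecMulVec ![(0 : ℝ), t] ![(0 : ℝ), t] = vecMulVec (ex71ColVec 0) (ex71ColVec 0) := by
    intro t ht
    ext p q
    fin_cases p <;> fin_cases q <;> simp [vecMulVec_apply, ex71ColVec, ht]
  have keyC1 : ∀ t : ℝ, t * t = 1 →
      vecMulVec ![t, σ * 0] ![t, σ * 0] = vecMulVec (ex71ColVec 1) (ex71ColVec 1) := by
    intro t ht
    ext p q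
    fin_cases p <;> fin_cases q <;> simp [vecMulVec_apply, ex71ColVec, ht]
  have keyC2 : ∀ p q : ℝ, p * p = 1 → q * q = 1 → p * q = 1 →
      vecMulVec ![p, q] ![p, q] = vecMulVec (ex71ColVec 2) (ex71ColVec 2) := by
    intro p q hp hq hpq
    have hqp : q * p = 1 := by rw [mul_comm]; exact hpq
    ext i j
    fin_cases i <;> fin_cases j <;> simp [vecMulVec_apply, ex71ColVec, hp, hq, hpq, hqp]
  refine ⟨Q * S, S * P, ?_, fun i => ⟨?_, ?_⟩⟩
  · rw [Matrix.mul_assoc, ← Matrix.mul_assoc S, hSS, Matrix.one_mul, hQP]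
  · -- rows: `(QS)ᵀ a_i a_iᵀ (QS) = ((a_i Q) S)((a_i Q) S)ᵀ`
    rw [(ha i).1, Matrix.mul_vecMulVec, Matrix.vecMulVec_mul, Matrix.mulVec_transpose,
      ← Matrix.vecMul_vecMul, hvS]
    fin_cases i
    · simp only [Fin.zero_eta, Fin.isValue, hrow0, Matrix.cons_val_zero, Matrix.cons_val_one]
      exact keyR0
    · simp only [Fin.mk_one, Fin.isValue, hrow1, Matrix.cons_val_zero, Matrix.cons_val_one]
      exact keyR1 σ hσ2
    · simp only [Fin.reduceFinMk, Fin.isValue, ← hw]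
      refine keyR2 (w 0) (σ * w 1) (by rw [← sq]; exact hx2) ?_ (by linarith [hσxy])
      calc σ * w 1 * (σ * w 1) = (σ * σ) * w 1 ^ 2 := by ring
        _ = 1 := by rw [hσ2, hy2, one_mul]
  · -- columns: `(SP) b_j b_jᵀ (SP)ᵀ = (S(P b_j))(S(P b_j))ᵀ`
    rw [(hb i).1, Matrix.mul_vecMulVec, Matrix.vecMulVec_mul, Matrix.vecMul_transpose,
      ← Matrix.mulVec_mulVec, hPv, hSv]
    fin_cases i
    · simp only [Fin.zero_eta, Fin.isValue, Matrix.cons_val_zero, Matrix.cons_val_one, horth 0]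
      refine keyC0 (σ * (a 1 ⬝ᵥ b 0)) ?_
      calc σ * (a 1 ⬝ᵥ b 0) * (σ * (a 1 ⬝ᵥ b 0)) = (σ * σ) * (a 1 ⬝ᵥ b 0) ^ 2 := by ring
        _ = 1 := by rw [hσ2, h10, one_mul]
    · simp only [Fin.mk_one, Fin.isValue, Matrix.cons_val_zero, Matrix.cons_val_one, horth 1]
      exact keyC1 (a 0 ⬝ᵥ b 1) (by rw [← sq]; exact h01)
    · simp only [Fin.reduceFinMk, Fin.isValue, Matrix.cons_val_zero, Matrix.cons_val_one]
      refine keyC2 (a 0 ⬝ᵥ b 2) (σ * (a 1 ⬝ᵥ b 2)) (by rw [← sq]; exact h02) ?_ ?_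
      · calc σ * (a 1 ⬝ᵥ b 2) * (σ * (a 1 ⬝ᵥ b 2)) = (σ * σ) * (a 1 ⬝ᵥ b 2) ^ 2 := by ring
          _ = 1 := by rw [hσ2, h12, one_mul]
      · calc (a 0 ⬝ᵥ b 2) * (σ * (a 1 ⬝ᵥ b 2)) = (a 0 ⬝ᵥ b 2) ^ 2 * (a 1 ⬝ᵥ b 2) ^ 2 := by
              rw [hσ]; ring
          _ = 1 := by rw [h02, h12, one_mul]

end Example71

/-! ### Example 7.7: a rank-three matrix with two explicit size-2 factorizations -/

section Example77

/-- The matrix of Example 7.7 (p21): `[[3,3,1,1],[1,3,3,1],[1,1,3,3],[3,1,1,3]]`.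
[cite: FawziEtAl2015, Ex. 7.7 (p21)] -/
def ex77Matrix : Matrix (Fin 4) (Fin 4) ℝ := !![3, 3, 1, 1; 1, 3, 3, 1; 1, 1, 3, 3; 3, 1, 1, 3]

/-- The printed rank factorization `M = U V` (p21). [cite: FawziEtAl2015, Ex. 7.7 (p21)] -/
def ex77U : Matrix (Fin 4) (Fin 3) ℝ := !![1, 1, 1; 1, 1, -1; 1, -1, -1; 1, -1, 1]

/-- The printed rank factorization `M = U V` (p21). [cite: FawziEtAl2015, Ex. 7.7 (p21)] -/
def ex77V : Matrix (Fin 3) (Fin 4) ℝ := !![2, 2, 2, 2; 0, 1, 0, -1; 1, 0, -1, 0]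

/-- `M = U V` as printed. [cite: FawziEtAl2015, Ex. 7.7 (p21)] -/
theorem ex77Matrix_eq_mul : ex77Matrix = ex77U * ex77V := by
  ext i j
  fin_cases i <;> fin_cases j <;> simp [ex77Matrix, ex77U, ex77V, Matrix.mul_apply, Fin.sum_univ_three] <;>
    norm_num

/-- **Example 7.7: "the following matrix `M` of rank three"** (p21): `rank M = 3` (the printed
factorization through `ℝ³`, and the nonzero minor on rows/columns `{0,1,2}`).
[cite: FawziEtAl2015, Ex. 7.7 (p21)] -/
theorem rank_ex77Matrix : ex77Matrix.rank = 3 := by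
  apply le_antisymm
  · calc ex77Matrix.rank = (ex77U * ex77V).rank := by rw [ex77Matrix_eq_mul]
      _ ≤ ex77U.rank := Matrix.rank_mul_le_left _ _
      _ ≤ Fintype.card (Fin 3) := Matrix.rank_le_width _
      _ = 3 := Fintype.card_fin 3
  · have h := Literature.LinearAlgebra.Matrix.card_le_rank_of_det_submatrix_ne_zero ex77Matrix
      (![0, 1, 2] : Fin 3 → Fin 4) (![0, 1, 2] : Fin 3 → Fin 4) (by
        simp [Matrix.det_fin_three, ex77Matrix]
        norm_num)
    simpa using h

/-- The second printed psd factorization of Example 7.7 (p22, "the ellipse … with horizontal axis of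
length four and vertical axis of length three"): row factors. [cite: FawziEtAl2015, Ex. 7.7 (p21–p22)] -/
def ex77RowFactor : Fin 4 → Matrix (Fin 2) (Fin 2) ℝ :=
  ![!![5/3, 1/2; 1/2, 1/3], !![1/3, 1/2; 1/2, 5/3], !![1/3, -1/2; -1/2, 5/3], !![5/3, -1/2; -1/2, 1/3]]

/-- The second printed psd factorization of Example 7.7: column factors.
[cite: FawziEtAl2015, Ex. 7.7 (p21–p22)] -/
def ex77ColFactor : Fin 4 → Matrix (Fin 2) (Fin 2) ℝ :=
  ![!![7/4, 0; 0, 1/4], !![1, 1; 1, 1], !![1/4, 0; 0, 7/4], !![1, -1; -1, 1]]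

/-- **FGPRT Example 7.7, second factorization** (p22): the eight displayed rational `2 × 2` matrices
are psd and factorize `M`; hence `rank_psd M ≤ 2` (and `= 2`, as `rank M = 3 > 1 = C(2,2)`).
[cite: FawziEtAl2015, Ex. 7.7 (p21–p22)] -/
theorem FawziEtAl2015_ex77 :
    (∀ i j, ex77Matrix i j = (ex77RowFactor i * ex77ColFactor j).trace) ∧
      HasPsdFactorization ex77Matrix 2 ∧ ¬ HasPsdFactorization ex77Matrix 1 := by
  have hfac : ∀ i j, ex77Matrix i j = (ex77RowFactor i * ex77ColFactor j).trace := by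
    intro i j
    fin_cases i <;> fin_cases j <;>
      norm_num [ex77Matrix, ex77RowFactor, ex77ColFactor, Matrix.trace, Matrix.mul_apply,
        Fin.sum_univ_two]
  have hA : ∀ i, (ex77RowFactor i).PosSemidef := by
    intro i
    fin_cases i <;> exact posSemidef_fin_two (by norm_num) (by norm_num) (by norm_num)
  have hB : ∀ j, (ex77ColFactor j).PosSemidef := by
    intro j
    fin_cases j <;> exact posSemidef_fin_two (by norm_num) (by norm_num) (by norm_num)
  refine ⟨hfac, ⟨ex77RowFactor, ex77ColFactor, hA, hB, hfac⟩, fun h => ?_⟩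
  have := h.rank_le_choose
  rw [rank_ex77Matrix] at this
  norm_num [Nat.choose] at this

/-- **FGPRT Example 7.7, first factorization** (p21, "For the circle centered at the origin with radius
`√2`", `α = 1/√2`): the displayed matrices `[[1±α, ±α],[±α, 1∓α]]` (rows) and `[[1+α,0],[0,1−α]]`,
`[[1,α],[α,1]]`, `[[1−α,0],[0,1+α]]`, `[[1,−α],[−α,1]]` (columns) are psd and factorize `M`
(all row factors and no column factor being singular: `det = 1 − 2α² = 0`, resp. `1 − α² = ½`).
[cite: FawziEtAl2015, Ex. 7.7 (p21)] -/
theorem FawziEtAl2015_ex77_circle :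
    let α : ℝ := 1 / Real.sqrt 2
    let A : Fin 4 → Matrix (Fin 2) (Fin 2) ℝ :=
      ![!![1 + α, α; α, 1 - α], !![1 - α, α; α, 1 + α], !![1 - α, -α; -α, 1 + α],
        !![1 + α, -α; -α, 1 - α]]
    let B : Fin 4 → Matrix (Fin 2) (Fin 2) ℝ :=
      ![!![1 + α, 0; 0, 1 - α], !![1, α; α, 1], !![1 - α, 0; 0, 1 + α], !![1, -α; -α, 1]]
    (∀ i, (A i).PosSemidef) ∧ (∀ j, (B j).PosSemidef) ∧
      ∀ i j, ex77Matrix i j = (A i * B j).trace := by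
  intro α A B
  have hα2 : α ^ 2 = 1 / 2 := by
    show (1 / Real.sqrt 2) ^ 2 = 1 / 2
    rw [div_pow, one_pow, Real.sq_sqrt (by norm_num)]
  have hα0 : 0 < α := by
    show 0 < 1 / Real.sqrt 2
    positivity
  have hα1 : α < 1 := by nlinarith
  refine ⟨fun i => ?_, fun j => ?_, fun i j => ?_⟩
  · fin_cases i <;> exact posSemidef_fin_two (by linarith) (by linarith) (by nlinarith)
  · fin_cases j <;>
      first
        | exact posSemidef_fin_two (by linarith) (by linarith) (by nlinarith)
  · fin_cases i <;> fin_cases j <;>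
      norm_num [ex77Matrix, A, B, Matrix.trace, Matrix.mul_apply, Fin.sum_univ_two] <;> nlinarith

end Example77

/-! ### Example 7.8: a psd-rank-two matrix all of whose factorizations need rank-two factors -/

section Example78

/-- The matrix of Example 7.8 (p22): `[[0,1,1,2],[1,0,1,2],[1,1,0,6],[1,1,3,3]]` — the derangement
matrix `D₃` bordered by "an extra vertex [row] … and an extra facet [column]".
[cite: FawziEtAl2015, Ex. 7.8 (p22)] -/
def ex78Matrix : Matrix (Fin 4) (Fin 4) ℝ := !![0, 1, 1, 2; 1, 0, 1, 2; 1, 1, 0, 6; 1, 1, 3, 3]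

/-- The printed rank factorization of Example 7.8 (p22). [cite: FawziEtAl2015, Ex. 7.8 (p22)] -/
def ex78U : Matrix (Fin 4) (Fin 3) ℝ := !![0, 1, 1; 1, 0, 1; 1, 1, 0; 1, 1, 3]

/-- The printed rank factorization of Example 7.8 (p22). [cite: FawziEtAl2015, Ex. 7.8 (p22)] -/
def ex78V : Matrix (Fin 3) (Fin 4) ℝ := !![1, 0, 0, 3; 0, 1, 0, 3; 0, 0, 1, -1]

/-- `M = U V` as printed. [cite: FawziEtAl2015, Ex. 7.8 (p22)] -/
theorem ex78Matrix_eq_mul : ex78Matrix = ex78U * ex78V := by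
  ext i j
  fin_cases i <;> fin_cases j <;> simp [ex78Matrix, ex78U, ex78V, Matrix.mul_apply, Fin.sum_univ_three] <;>
    norm_num

/-- `rank M = 3` for the matrix of Example 7.8. [cite: FawziEtAl2015, Ex. 7.8 (p22)] -/
theorem rank_ex78Matrix : ex78Matrix.rank = 3 := by
  apply le_antisymm
  · calc ex78Matrix.rank = (ex78U * ex78V).rank := by rw [ex78Matrix_eq_mul]
      _ ≤ ex78U.rank := Matrix.rank_mul_le_left _ _
      _ ≤ Fintype.card (Fin 3) := Matrix.rank_le_width _
      _ = 3 := Fintype.card_fin 3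
  · have h := Literature.LinearAlgebra.Matrix.card_le_rank_of_det_submatrix_ne_zero ex78Matrix
      (![0, 1, 2] : Fin 3 → Fin 4) (![0, 1, 2] : Fin 3 → Fin 4) (by
        simp [Matrix.det_fin_three, ex78Matrix])
    simpa using h

/-- The top-left `3 × 3` block of the Example 7.8 matrix is `D₃`. [cite: FawziEtAl2015, Ex. 7.8 (p22)] -/
theorem ex78Matrix_castSucc (i j : Fin 3) :
    ex78Matrix (Fin.castSucc i) (Fin.castSucc j) = derangementMatrix 3 i j := by
  fin_cases i <;> fin_cases j <;> simp [ex78Matrix]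

/-- The printed psd factorization of Example 7.8 (p22): the `D₃` factorization of Example 7.1
"augment[ed] … with the matrix `[[1,½],[½,1]]` for the new vertex"; row factors.
[cite: FawziEtAl2015, Ex. 7.8 (p22)] -/
def ex78RowFactor : Fin 4 → Matrix (Fin 2) (Fin 2) ℝ :=
  ![!![1, 0; 0, 0], !![0, 0; 0, 1], !![1, -1; -1, 1], !![1, 1/2; 1/2, 1]]

/-- … "and the matrix `[[2,−1],[−1,2]]` for the new facet"; column factors.
[cite: FawziEtAl2015, Ex. 7.8 (p22)] -/
def ex78ColFactor : Fin 4 → Matrix (Fin 2) (Fin 2) ℝ :=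
  ![!![0, 0; 0, 1], !![1, 0; 0, 0], !![1, 1; 1, 1], !![2, -1; -1, 2]]

/-- **FGPRT Example 7.8, the factorization** (p22): the printed matrices are psd and factorize `M`, so
`rank_psd M ≤ 2`; `rank_psd M = 2` since `rank M = 3`. [cite: FawziEtAl2015, Ex. 7.8 (p22)] -/
theorem FawziEtAl2015_ex78_factorization :
    (∀ i j, ex78Matrix i j = (ex78RowFactor i * ex78ColFactor j).trace) ∧
      HasPsdFactorization ex78Matrix 2 ∧ ¬ HasPsdFactorization ex78Matrix 1 := by
  have hfac : ∀ i j, ex78Matrix i j = (ex78RowFactor i * ex78ColFactor j).trace := by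
    intro i j
    fin_cases i <;> fin_cases j <;>
      norm_num [ex78Matrix, ex78RowFactor, ex78ColFactor, Matrix.trace, Matrix.mul_apply,
        Fin.sum_univ_two]
  have hA : ∀ i, (ex78RowFactor i).PosSemidef := by
    intro i
    fin_cases i <;> exact posSemidef_fin_two (by norm_num) (by norm_num) (by norm_num)
  have hB : ∀ j, (ex78ColFactor j).PosSemidef := by
    intro j
    fin_cases j <;> exact posSemidef_fin_two (by norm_num) (by norm_num) (by norm_num)
  refine ⟨hfac, ⟨ex78RowFactor, ex78ColFactor, hA, hB, hfac⟩, fun h => ?_⟩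
  have := h.rank_le_choose
  rw [rank_ex78Matrix] at this
  norm_num [Nat.choose] at this

/-- **FGPRT Example 7.8** (p22, verbatim): "we present a `4 × 4` matrix with psd rank two such that every
`2 × 2` psd factorization must have a rank two matrix on a row and a rank two matrix on a column … the
matrix corresponding to the new vertex must lie in the interior of `S²_+` and the matrix corresponding
to the new facet must lie in the interior of `(S²_+)^*`. Hence, they must have rank two." Typed: in
every size-`2` psd factorization `(A_i, B_j)` of `M`, the last row factor `A₃` and the last column
factor `B₃` are nonsingular (rank two). The printed proof is geometric (uniqueness of the nested circle
of Remark 7.6); the proof here is algebraic: by Example 7.1 the `D₃`-block factors are `a_i a_iᵀ`,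
`b_j b_jᵀ` with `a_i ⊥ b_i`, `⟨a_i,b_j⟩² = 1`; `b₀, b₁` is a basis of `ℝ²` and `b₂ = γ b₀ + δ b₁` with
`γ² = δ² = 1`; a singular `A₃ = c cᵀ` would need `⟨c,b₀⟩² = ⟨c,b₁⟩² = 1` and `⟨c,b₂⟩² = 3`, but
`⟨c,b₂⟩ = ±1 ± 1 ∈ {0, ±2}`; dually a singular `B₃ = d dᵀ` would need `⟨a_i,d⟩² = 2, 2, 6` with
`⟨a₂, d⟩ = ±√2 ± √2`. [cite: FawziEtAl2015, Ex. 7.8 (p22)] -/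
theorem FawziEtAl2015_ex78_rankTwo (A B : Fin 4 → Matrix (Fin 2) (Fin 2) ℝ)
    (hA : ∀ i, (A i).PosSemidef) (hB : ∀ j, (B j).PosSemidef)
    (hM : ∀ i j, ex78Matrix i j = (A i * B j).trace) :
    (A 3).det ≠ 0 ∧ (B 3).det ≠ 0 := by
  -- the `D₃` block
  obtain ⟨a, b, ha, hb, horth, hone⟩ := FawziEtAl2015_ex71_rankOne (fun i => A (Fin.castSucc i))
    (fun j => B (Fin.castSucc j)) (fun i => hA _) (fun j => hB _)
    (fun i j => by rw [← ex78Matrix_castSucc, hM])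
  have htrAB : ∀ (v w : Fin 2 → ℝ), (vecMulVec v v * vecMulVec w w).trace = (v ⬝ᵥ w) ^ 2 :=
    fun v w => trace_vecMulVec_mul_vecMulVec v w
  -- entries of the last row / column against the block
  have hrow : ∀ j : Fin 3, (A 3 * vecMulVec (b j) (b j)).trace = ex78Matrix 3 (Fin.castSucc j) := by
    intro j; rw [hM, (hb j).1]
  have hcol : ∀ i : Fin 3, (vecMulVec (a i) (a i) * B 3).trace = ex78Matrix (Fin.castSucc i) 3 := by
    intro i; rw [hM, (ha i).1]
  have h01 : (a 0 ⬝ᵥ b 1) ^ 2 = 1 := hone 0 1 (by decide)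
  have h10 : (a 1 ⬝ᵥ b 0) ^ 2 = 1 := hone 1 0 (by decide)
  have h02 : (a 0 ⬝ᵥ b 2) ^ 2 = 1 := hone 0 2 (by decide)
  have h12 : (a 1 ⬝ᵥ b 2) ^ 2 = 1 := hone 1 2 (by decide)
  have h20 : (a 2 ⬝ᵥ b 0) ^ 2 = 1 := hone 2 0 (by decide)
  have h21 : (a 2 ⬝ᵥ b 1) ^ 2 = 1 := hone 2 1 (by decide)
  constructor
  · -- a singular `A₃ = c cᵀ` is impossible
    intro hdet
    obtain ⟨c, hc⟩ := exists_eq_vecMulVec_of_det_eq_zero (hA 3) hdet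
    have hc0 : (c ⬝ᵥ b 0) ^ 2 = 1 := by
      rw [← htrAB, ← hc, hrow 0]; simp [ex78Matrix]
    have hc1 : (c ⬝ᵥ b 1) ^ 2 = 1 := by
      rw [← htrAB, ← hc, hrow 1]; simp [ex78Matrix]
    have hc2 : (c ⬝ᵥ b 2) ^ 2 = 3 := by
      rw [← htrAB, ← hc, hrow 2]; simp [ex78Matrix]
    -- `b₀, b₁` is a basis; `b₂ = γ b₀ + δ b₁` with `γ² = δ² = 1`
    have hD : b 0 0 * b 1 1 - b 0 1 * b 1 0 ≠ 0 :=
      det_ne_zero_of_orth (horth 0) (hb 0).2 (fun h => by rw [h] at h01; norm_num at h01)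
    obtain ⟨γ, δ, hγδ⟩ := exists_coords_fin_two (b 0) (b 1) (b 2) hD
    have hexp : ∀ w : Fin 2 → ℝ, w ⬝ᵥ b 2 = γ * (w ⬝ᵥ b 0) + δ * (w ⬝ᵥ b 1) := fun w => by
      rw [hγδ, dotProduct_add, dotProduct_smul, dotProduct_smul, smul_eq_mul, smul_eq_mul]
    have hδ : δ ^ 2 = 1 := by
      have := h02
      rw [hexp, horth 0, mul_zero, zero_add, mul_pow, h01, mul_one] at this
      exact this
    have hγ : γ ^ 2 = 1 := by
      have := h12
      rw [hexp, horth 1, mul_zero, add_zero, mul_pow, h10, mul_one] at this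
      exact this
    have hx : (γ * (c ⬝ᵥ b 0)) ^ 2 = 1 := by rw [mul_pow, hγ, hc0, one_mul]
    have hy : (δ * (c ⬝ᵥ b 1)) ^ 2 = 1 := by rw [mul_pow, hδ, hc1, one_mul]
    rw [hexp] at hc2
    rcases sq_add_sq_cases hx hy hc2 with h | h <;> norm_num at h
  · -- a singular `B₃ = d dᵀ` is impossible
    intro hdet
    obtain ⟨d, hd⟩ := exists_eq_vecMulVec_of_det_eq_zero (hB 3) hdet
    have hd0 : (a 0 ⬝ᵥ d) ^ 2 = 2 := by
      rw [← htrAB, ← hd, hcol 0]; simp [ex78Matrix]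
    have hd1 : (a 1 ⬝ᵥ d) ^ 2 = 2 := by
      rw [← htrAB, ← hd, hcol 1]; simp [ex78Matrix]
    have hd2 : (a 2 ⬝ᵥ d) ^ 2 = 6 := by
      rw [← htrAB, ← hd, hcol 2]; simp [ex78Matrix]
    -- `a₀, a₁` is a basis; `a₂ = γ a₀ + δ a₁` with `γ² = δ² = 1`
    have horth' : b 0 ⬝ᵥ a 0 = 0 := by rw [dotProduct_comm]; exact horth 0
    have hD : a 0 0 * a 1 1 - a 0 1 * a 1 0 ≠ 0 :=
      det_ne_zero_of_orth horth' (ha 0).2 (fun h => by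
        rw [dotProduct_comm] at h; rw [h] at h10; norm_num at h10)
    obtain ⟨γ, δ, hγδ⟩ := exists_coords_fin_two (a 0) (a 1) (a 2) hD
    have hexp : ∀ w : Fin 2 → ℝ, a 2 ⬝ᵥ w = γ * (a 0 ⬝ᵥ w) + δ * (a 1 ⬝ᵥ w) := fun w => by
      rw [hγδ, add_dotProduct, smul_dotProduct, smul_dotProduct, smul_eq_mul, smul_eq_mul]
    have hδ : δ ^ 2 = 1 := by
      have := h20
      rw [hexp, horth 0, mul_zero, zero_add, mul_pow, h10, mul_one] at this
      exact this
    have hγ : γ ^ 2 = 1 := by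
      have := h21
      rw [hexp, horth 1, mul_zero, add_zero, mul_pow, h01, mul_one] at this
      exact this
    have hx : (γ * (a 0 ⬝ᵥ d)) ^ 2 = 2 := by rw [mul_pow, hγ, hd0, one_mul]
    have hy : (δ * (a 1 ⬝ᵥ d)) ^ 2 = 2 := by rw [mul_pow, hδ, hd1, one_mul]
    rw [hexp] at hd2
    rcases sq_add_sq_cases hx hy hd2 with h | h <;> norm_num at h

/-- The first three displayed factors of Example 7.8 are the Example-7.1 factors `a_i a_iᵀ`, `b_j b_jᵀ`.
[cite: FawziEtAl2015, Ex. 7.8 (p22)] -/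
theorem ex78RowFactor_castSucc (i : Fin 3) :
    ex78RowFactor (Fin.castSucc i) = vecMulVec (ex71RowVec i) (ex71RowVec i) := by
  ext s t
  fin_cases i <;> fin_cases s <;> fin_cases t <;> simp [ex78RowFactor, ex71RowVec, vecMulVec_apply]

/-- (Column version.) [cite: FawziEtAl2015, Ex. 7.8 (p22)] -/
theorem ex78ColFactor_castSucc (j : Fin 3) :
    ex78ColFactor (Fin.castSucc j) = vecMulVec (ex71ColVec j) (ex71ColVec j) := by
  ext s t
  fin_cases j <;> fin_cases s <;> fin_cases t <;> simp [ex78ColFactor, ex71ColVec, vecMulVec_apply]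

/-- The trace pairing is invariant under the `GL(2)`-action: `⟨LᵀAL, L'BL'ᵀ⟩ = ⟨A, B⟩` when `LL' = I`.
[cite: FawziEtAl2015, §7 (p20)] -/
private theorem trace_conj_pair {A B L L' : Matrix (Fin 2) (Fin 2) ℝ} (hLL' : L * L' = 1) :
    (Lᵀ * A * L * (L' * B * L'ᵀ)).trace = (A * B).trace := by
  have h1 : Lᵀ * A * L * (L' * B * L'ᵀ) = Lᵀ * (A * B) * L'ᵀ := by
    calc Lᵀ * A * L * (L' * B * L'ᵀ) = Lᵀ * A * (L * L') * B * L'ᵀ := by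
          simp only [Matrix.mul_assoc]
      _ = Lᵀ * (A * B) * L'ᵀ := by rw [hLL', Matrix.mul_one]; simp only [Matrix.mul_assoc]
  rw [h1, Matrix.trace_mul_cycle, ← transpose_mul, hLL', transpose_one, Matrix.one_mul]

/-- `⟨X, b bᵀ⟩` for the three Example-7.1 column vectors `b = (0,1), (1,0), (1,1)` reads off
`X₁₁`, `X₀₀`, `X₀₀ + X₀₁ + X₁₀ + X₁₁`. [folklore] -/
private theorem trace_mul_vecMulVec_fin_two (X : Matrix (Fin 2) (Fin 2) ℝ) (b : Fin 2 → ℝ) :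
    (X * vecMulVec b b).trace = X 0 0 * (b 0 * b 0) + X 0 1 * (b 1 * b 0) + X 1 0 * (b 0 * b 1) +
      X 1 1 * (b 1 * b 1) := by
  simp only [Matrix.trace, Matrix.diag_apply, Matrix.mul_apply, vecMulVec_apply, Fin.sum_univ_two]
  ring

/-- (Row version: `⟨a aᵀ, Y⟩`.) [folklore] -/
private theorem trace_vecMulVec_mul_fin_two (Y : Matrix (Fin 2) (Fin 2) ℝ) (a : Fin 2 → ℝ) :
    (vecMulVec a a * Y).trace = a 0 * a 0 * Y 0 0 + a 0 * a 1 * Y 1 0 + a 1 * a 0 * Y 0 1 +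
      a 1 * a 1 * Y 1 1 := by
  simp only [Matrix.trace, Matrix.diag_apply, Matrix.mul_apply, vecMulVec_apply, Fin.sum_univ_two]
  ring

/-- **FGPRT Example 7.8, "the space of factorizations consists of a single orbit"** (p22, verbatim:
"The same circle as before is still the unique ellipse nested between the two polytopes so the space of
factorizations consists of a single orbit. When we construct a psd factorization in this orbit, the
matrix corresponding to the new vertex must lie in the interior of `S²_+` …"). Typed: EVERY size-`2`
psd factorization `(A_i, B_j)` of the Example-7.8 matrix is conjugate to the displayed one —
`LᵀA_iL = ex78RowFactor i` and `L'B_jL'ᵀ = ex78ColFactor j` for all `i, j` with `LL' = I`. The printed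
argument is geometric (uniqueness of the nested circle); the proof here is algebraic: Example 7.1's
single orbit (`FawziEtAl2015_ex71_singleOrbit`) conjugates the `D₃` block to the displayed rank-one
factors `a_ia_iᵀ`, `b_jb_jᵀ`, and the bordering factors are then forced by their pairings with these:
`X = LᵀA₃L` has `X₁₁ = 1`, `X₀₀ = 1`, `X₀₀ + 2X₀₁ + X₁₁ = 3`, i.e. `X = [[1,½],[½,1]]`, and `Y = L'B₃L'ᵀ`
has `Y₀₀ = 2`, `Y₁₁ = 2`, `Y₀₀ − 2Y₀₁ + Y₁₁ = 6`, i.e. `Y = [[2,−1],[−1,2]]`.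
[cite: FawziEtAl2015, Ex. 7.8 (p22)] -/
theorem FawziEtAl2015_ex78_singleOrbit (A B : Fin 4 → Matrix (Fin 2) (Fin 2) ℝ)
    (hA : ∀ i, (A i).PosSemidef) (hB : ∀ j, (B j).PosSemidef)
    (hM : ∀ i j, ex78Matrix i j = (A i * B j).trace) :
    ∃ L L' : Matrix (Fin 2) (Fin 2) ℝ, L * L' = 1 ∧
      ∀ i, Lᵀ * A i * L = ex78RowFactor i ∧ L' * B i * L'ᵀ = ex78ColFactor i := by
  obtain ⟨L, L', hLL', hblock⟩ := FawziEtAl2015_ex71_singleOrbit (fun i => A (Fin.castSucc i))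
    (fun j => B (Fin.castSucc j)) (fun i => hA _) (fun j => hB _)
    (fun i j => by rw [← ex78Matrix_castSucc, hM])
  have hArow : ∀ i : Fin 3, Lᵀ * A (Fin.castSucc i) * L = ex78RowFactor (Fin.castSucc i) := fun i => by
    rw [ex78RowFactor_castSucc]; exact (hblock i).1
  have hBcol : ∀ j : Fin 3, L' * B (Fin.castSucc j) * L'ᵀ = ex78ColFactor (Fin.castSucc j) := fun j => by
    rw [ex78ColFactor_castSucc]; exact (hblock j).2
  -- the conjugated bordering factors and their pairings with the block factors
  set X := Lᵀ * A 3 * L with hX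
  set Y := L' * B 3 * L'ᵀ with hY
  have hXsymm : X 1 0 = X 0 1 := by
    have h3 : (A 3).IsHermitian := (hA 3).1
    rw [Matrix.IsHermitian, conjTranspose_eq_transpose_of_trivial] at h3
    have hXt : Xᵀ = X := by
      rw [hX, transpose_mul, transpose_mul, transpose_transpose, h3, Matrix.mul_assoc]
    have := congrFun (congrFun hXt 1) 0
    rw [transpose_apply] at this
    exact this.symm
  have hYsymm : Y 1 0 = Y 0 1 := by
    have h3 : (B 3).IsHermitian := (hB 3).1
    rw [Matrix.IsHermitian, conjTranspose_eq_transpose_of_trivial] at h3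
    have hYt : Yᵀ = Y := by
      rw [hY, transpose_mul, transpose_mul, transpose_transpose, h3, Matrix.mul_assoc]
    have := congrFun (congrFun hYt 1) 0
    rw [transpose_apply] at this
    exact this.symm
  have eX : ∀ j : Fin 3, (X * vecMulVec (ex71ColVec j) (ex71ColVec j)).trace =
      ex78Matrix 3 (Fin.castSucc j) := by
    intro j
    rw [← (hblock j).2, hX, trace_conj_pair hLL', ← hM]
  have eY : ∀ i : Fin 3, (vecMulVec (ex71RowVec i) (ex71RowVec i) * Y).trace =
      ex78Matrix (Fin.castSucc i) 3 := by
    intro i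
    rw [← (hblock i).1, hY, trace_conj_pair hLL', ← hM]
  have eX0 : X 1 1 = 1 := by
    have h := eX 0
    rw [trace_mul_vecMulVec_fin_two] at h
    simp [ex71ColVec, ex78Matrix] at h
    linarith
  have eX1 : X 0 0 = 1 := by
    have h := eX 1
    rw [trace_mul_vecMulVec_fin_two] at h
    simp [ex71ColVec, ex78Matrix] at h
    linarith
  have eX2 : X 0 0 + X 0 1 + X 1 0 + X 1 1 = 3 := by
    have h := eX 2
    rw [trace_mul_vecMulVec_fin_two] at h
    simp [ex71ColVec, ex78Matrix] at h
    linarith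
  have eY0 : Y 0 0 = 2 := by
    have h := eY 0
    rw [trace_vecMulVec_mul_fin_two] at h
    simp [ex71RowVec, ex78Matrix] at h
    linarith
  have eY1 : Y 1 1 = 2 := by
    have h := eY 1
    rw [trace_vecMulVec_mul_fin_two] at h
    simp [ex71RowVec, ex78Matrix] at h
    linarith
  have eY2 : Y 0 0 - Y 1 0 - Y 0 1 + Y 1 1 = 6 := by
    have h := eY 2
    rw [trace_vecMulVec_mul_fin_two] at h
    simp [ex71RowVec, ex78Matrix] at h
    linarith
  have hX00 : X 0 0 = 1 := eX1
  have hX11 : X 1 1 = 1 := eX0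
  have hX01 : X 0 1 = 1 / 2 := by linarith
  have hY00 : Y 0 0 = 2 := eY0
  have hY11 : Y 1 1 = 2 := eY1
  have hY01 : Y 0 1 = -1 := by linarith
  refine ⟨L, L', hLL', fun i => ?_⟩
  fin_cases i
  · exact ⟨hArow 0, hBcol 0⟩
  · exact ⟨hArow 1, hBcol 1⟩
  · exact ⟨hArow 2, hBcol 2⟩
  · refine ⟨?_, ?_⟩
    · change X = ex78RowFactor 3
      ext s t
      fin_cases s <;> fin_cases t <;> simp [ex78RowFactor, hX00, hX01, hX11, hXsymm]
    · change Y = ex78ColFactor 3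
      ext s t
      fin_cases s <;> fin_cases t <;> simp [ex78ColFactor, hY00, hY01, hY11, hYsymm]

end Example78

/-! ### The space of factorizations `𝒮ℱ(M)` (§7 warm-up, p20): orbits, closedness, infinitude -/

section Space

variable {ι κ : Type*} {k : ℕ}

/-- **The space of psd factorizations** `𝒮ℱ(M)` of size `k` of a matrix `M` (FGPRT §7, p20: "the set
of matrices `(A_1,…,A_p,B_1,…,B_q) ∈ (S^k)^{p+q}` such that each of the component matrices is psd and
`M_{ij} = ⟨A_i, B_j⟩`"; the survey takes `k = rank_psd M`, here `k` is a parameter), as a subset of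
`(S^k)^p × (S^k)^q`. [cite: FawziEtAl2015, §7 (p20)] -/
def psdFactorizationSpace (M : Matrix ι κ ℝ) (k : ℕ) :
    Set ((ι → Matrix (Fin k) (Fin k) ℝ) × (κ → Matrix (Fin k) (Fin k) ℝ)) :=
  {AB | (∀ i, (AB.1 i).PosSemidef) ∧ (∀ j, (AB.2 j).PosSemidef) ∧
    ∀ i j, M i j = (AB.1 i * AB.2 j).trace}

/-- Membership in `𝒮ℱ(M)` unfolded. [cite: FawziEtAl2015, §7 (p20)] -/
theorem mem_psdFactorizationSpace_iff {M : Matrix ι κ ℝ} {A : ι → Matrix (Fin k) (Fin k) ℝ}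
    {B : κ → Matrix (Fin k) (Fin k) ℝ} :
    (A, B) ∈ psdFactorizationSpace M k ↔
      (∀ i, (A i).PosSemidef) ∧ (∀ j, (B j).PosSemidef) ∧ ∀ i j, M i j = (A i * B j).trace :=
  Iff.rfl

/-- `𝒮ℱ(M)` at size `k` is nonempty exactly when `rank_psd M ≤ k`. [cite: FawziEtAl2015, §7 (p20)] -/
theorem psdFactorizationSpace_nonempty_iff {M : Matrix ι κ ℝ} :
    (psdFactorizationSpace M k).Nonempty ↔ HasPsdFactorization M k := by
  constructor
  · rintro ⟨⟨A, B⟩, hA, hB, hM⟩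
    exact ⟨A, B, hA, hB, hM⟩
  · rintro ⟨A, B, hA, hB, hM⟩
    exact ⟨⟨A, B⟩, hA, hB, hM⟩

/-- **The `GL(k)`-orbit** (p20, verbatim): "for any psd factorization `(A_1,…,B_q)` and any matrix
`L ∈ GL(k)` …, the matrices `(Lᵀ A_1 L,…,L⁻¹ B_q L⁻ᵀ)` also form a psd factorization of `M`"
(`Tr(LᵀA L · L⁻¹ B L⁻ᵀ) = Tr(A B)`). [cite: FawziEtAl2015, §7 (p20)] -/
theorem conj_mem_psdFactorizationSpace {M : Matrix ι κ ℝ} {A : ι → Matrix (Fin k) (Fin k) ℝ}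
    {B : κ → Matrix (Fin k) (Fin k) ℝ} (h : (A, B) ∈ psdFactorizationSpace M k)
    (L : Matrix (Fin k) (Fin k) ℝ) (hL : IsUnit L.det) :
    ((fun i => Lᵀ * A i * L), fun j => L⁻¹ * B j * L⁻¹ᵀ) ∈ psdFactorizationSpace M k := by
  obtain ⟨hA, hB, hM⟩ := h
  refine ⟨fun i => ?_, fun j => ?_, fun i j => ?_⟩
  · simpa only [conjTranspose_eq_transpose_of_trivial] using (hA i).conjTranspose_mul_mul_same L
  · simpa only [conjTranspose_eq_transpose_of_trivial] using (hB j).mul_mul_conjTranspose_same L⁻¹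
  · change M i j = (Lᵀ * A i * L * (L⁻¹ * B j * L⁻¹ᵀ)).trace
    have h1 : L * L⁻¹ = 1 := Matrix.mul_nonsing_inv L hL
    have h2 : L⁻¹ᵀ * Lᵀ = 1 := by rw [← Matrix.transpose_mul, h1, Matrix.transpose_one]
    calc M i j = (A i * B j).trace := hM i j
      _ = (A i * (L * L⁻¹) * B j * (L⁻¹ᵀ * Lᵀ)).trace := by rw [h1, h2, Matrix.mul_one, Matrix.mul_one]
      _ = (Lᵀ * (A i * L * L⁻¹ * B j * L⁻¹ᵀ)).trace := by
          rw [Matrix.trace_mul_comm Lᵀ]; simp only [Matrix.mul_assoc]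
      _ = (Lᵀ * A i * L * (L⁻¹ * B j * L⁻¹ᵀ)).trace := by simp only [Matrix.mul_assoc]

/-- **`𝒮ℱ(M)` is infinite** (p20: "it is straightforward to see that `𝒮ℱ(M)` is closed and infinite"):
scaling `(c² A_i, c⁻² B_j)` (the orbit of `L = c I`) gives infinitely many factorizations as soon as
one factorization with some `A_i ≠ 0` exists (i.e. `M ≠ 0`). [cite: FawziEtAl2015, §7 (p20)] -/
theorem psdFactorizationSpace_infinite {M : Matrix ι κ ℝ} {A : ι → Matrix (Fin k) (Fin k) ℝ}
    {B : κ → Matrix (Fin k) (Fin k) ℝ} (h : (A, B) ∈ psdFactorizationSpace M k) (hA0 : A ≠ 0) :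
    (psdFactorizationSpace M k).Infinite := by
  obtain ⟨hA, hB, hM⟩ := h
  -- the family `n ↦ ((n+1)² A, (n+1)⁻² B)`
  let f : ℕ → (ι → Matrix (Fin k) (Fin k) ℝ) × (κ → Matrix (Fin k) (Fin k) ℝ) :=
    fun n => (((n : ℝ) + 1) ^ 2 • A, (((n : ℝ) + 1) ^ 2)⁻¹ • B)
  have hmem : ∀ n, f n ∈ psdFactorizationSpace M k := by
    intro n
    have hpos : (0 : ℝ) < ((n : ℝ) + 1) ^ 2 := by positivity
    refine ⟨fun i => ?_, fun j => ?_, fun i j => ?_⟩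
    · simpa [f] using (hA i).smul hpos.le
    · simpa [f] using (hB j).smul (inv_nonneg.mpr hpos.le)
    · simp only [f, Pi.smul_apply, Matrix.smul_mul, Matrix.mul_smul, Matrix.trace_smul, smul_eq_mul]
      rw [← mul_assoc, inv_mul_cancel₀ hpos.ne', one_mul]
      exact hM i j
  have hinj : Function.Injective f := by
    intro m n hmn
    obtain ⟨i, hi⟩ := Function.ne_iff.mp hA0
    obtain ⟨s, hs⟩ := Function.ne_iff.mp hi
    obtain ⟨t, hst⟩ := Function.ne_iff.mp hs
    have h1 := congrArg (fun AB => AB.1 i s t) hmn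
    simp only [f, Pi.smul_apply, Matrix.smul_apply, smul_eq_mul] at h1
    have h2 : ((m : ℝ) + 1) ^ 2 = ((n : ℝ) + 1) ^ 2 := mul_right_cancel₀ hst h1
    have h3 : (m : ℝ) + 1 = (n : ℝ) + 1 := by
      nlinarith [sq_nonneg ((m : ℝ) + 1 - ((n : ℝ) + 1)), sq_nonneg ((m : ℝ) + 1 + ((n : ℝ) + 1)),
        (by positivity : (0 : ℝ) < (m : ℝ) + 1), (by positivity : (0 : ℝ) < (n : ℝ) + 1)]
    exact_mod_cast (add_right_cancel h3 : (m : ℝ) = n)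
  exact Set.infinite_of_injective_forall_mem hinj hmem

/-- The real psd `k × k` matrices form a closed set ("Since `S^k_+` is closed", proof of Thm. 2.12).
[cite: FawziEtAl2015, proof of Thm. 2.12 (p08)] -/
private theorem isClosed_setOf_posSemidef_sf (k : ℕ) :
    IsClosed {X : Matrix (Fin k) (Fin k) ℝ | X.PosSemidef} := by
  have hset : {X : Matrix (Fin k) (Fin k) ℝ | X.PosSemidef} =
      {X | Xᴴ = X} ∩ ⋂ x : Fin k → ℝ, {X | 0 ≤ star x ⬝ᵥ (X *ᵥ x)} := by
    ext X
    simp only [Set.mem_setOf_eq, Set.mem_inter_iff, Set.mem_iInter, posSemidef_iff_dotProduct_mulVec,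
      Matrix.IsHermitian]
  rw [hset]
  refine (isClosed_eq continuous_id.matrix_conjTranspose continuous_id).inter ?_
  exact isClosed_iInter fun x => isClosed_le continuous_const
    (continuous_const.dotProduct (continuous_id.matrix_mulVec continuous_const))

/-- **`𝒮ℱ(M)` is closed** (p20) in `(S^k)^p × (S^k)^q`: psd-ness of each component and each equation
`M_{ij} = ⟨A_i, B_j⟩` are closed conditions. [cite: FawziEtAl2015, §7 (p20)] -/
theorem isClosed_psdFactorizationSpace (M : Matrix ι κ ℝ) (k : ℕ) :
    IsClosed (psdFactorizationSpace M k) := by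
  have hset : psdFactorizationSpace M k =
      (⋂ i, {AB | (AB.1 i).PosSemidef}) ∩ (⋂ j, {AB | (AB.2 j).PosSemidef}) ∩
        ⋂ i, ⋂ j, {AB : (ι → Matrix (Fin k) (Fin k) ℝ) × (κ → Matrix (Fin k) (Fin k) ℝ) |
          M i j = (AB.1 i * AB.2 j).trace} := by
    ext AB
    simp only [psdFactorizationSpace, Set.mem_setOf_eq, Set.mem_inter_iff, Set.mem_iInter, and_assoc]
  rw [hset]
  refine ((isClosed_iInter fun i => ?_).inter (isClosed_iInter fun j => ?_)).inter
    (isClosed_iInter fun i => isClosed_iInter fun j => ?_)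
  · have hc : Continuous fun AB : (ι → Matrix (Fin k) (Fin k) ℝ) × (κ → Matrix (Fin k) (Fin k) ℝ) =>
        AB.1 i := (continuous_apply i).comp continuous_fst
    exact (isClosed_setOf_posSemidef_sf k).preimage hc
  · have hc : Continuous fun AB : (ι → Matrix (Fin k) (Fin k) ℝ) × (κ → Matrix (Fin k) (Fin k) ℝ) =>
        AB.2 j := (continuous_apply j).comp continuous_snd
    exact (isClosed_setOf_posSemidef_sf k).preimage hc
  · exact isClosed_eq continuous_const
      ((((continuous_apply i).comp continuous_fst).matrix_mul
        ((continuous_apply j).comp continuous_snd)).matrix_trace)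

end Space

/-! ### Counting dimensions (§7, p20–p21): the factors of a size-`k` factorization of a matrix of rank
`C(k+1,2)` span `S^k` -/

section CountDimensions

variable {ι κ : Type*} {k : ℕ}

/-- The row map `X ↦ (⟨X, B_j⟩)_j` of a family of second factors. [folklore] -/
private def traceRowMap (B : κ → Matrix (Fin k) (Fin k) ℝ) :
    Matrix (Fin k) (Fin k) ℝ →ₗ[ℝ] (κ → ℝ) where
  toFun X j := (X * B j).trace
  map_add' X Y := by ext j; simp [Matrix.add_mul, Matrix.trace_add]
  map_smul' c X := by ext j; simp [Matrix.trace_smul]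

/-- **Rank versus the span of the factors**: if `M_{ij} = ⟨A_i, B_j⟩` then the rows of `M` are the images
of the `A_i` under the linear map `X ↦ (⟨X, B_j⟩)_j`, so `rank M ≤ dim span{A_i}` ("else we could find a
lower dimensional rank factorization of `M`", proof of Prop. 7.3).
[cite: FawziEtAl2015, proof of Prop. 7.3 (p21)] -/
theorem rank_le_finrank_span_rowFactors [Fintype ι] [Fintype κ] {M : Matrix ι κ ℝ} (A : ι → Matrix (Fin k) (Fin k) ℝ)
    (B : κ → Matrix (Fin k) (Fin k) ℝ) (hM : ∀ i j, M i j = (A i * B j).trace) :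
    M.rank ≤ Module.finrank ℝ (Submodule.span ℝ (Set.range A)) := by
  classical
  have hrow : Set.range M.row = traceRowMap B '' Set.range A := by
    ext v
    constructor
    · rintro ⟨i, rfl⟩
      exact ⟨A i, ⟨i, rfl⟩, funext fun j => (hM i j).symm⟩
    · rintro ⟨_, ⟨i, rfl⟩, rfl⟩
      exact ⟨i, funext fun j => hM i j⟩
  rw [Matrix.rank_eq_finrank_span_row, hrow, Submodule.span_image]
  exact Submodule.finrank_map_le _ _

/-- The column version: `rank M ≤ dim span{B_j}`. [cite: FawziEtAl2015, proof of Prop. 7.3 (p21)] -/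
theorem rank_le_finrank_span_colFactors [Fintype ι] [Fintype κ] {M : Matrix ι κ ℝ} (A : ι → Matrix (Fin k) (Fin k) ℝ)
    (B : κ → Matrix (Fin k) (Fin k) ℝ) (hM : ∀ i j, M i j = (A i * B j).trace) :
    M.rank ≤ Module.finrank ℝ (Submodule.span ℝ (Set.range B)) := by
  rw [← Matrix.rank_transpose]
  exact rank_le_finrank_span_rowFactors (M := Mᵀ) B A fun j i => by
    rw [Matrix.transpose_apply, hM, Matrix.trace_mul_comm]

/-- Filling a symmetric matrix from unordered-pair data (a linear parametrisation of `S^k` by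
`ℝ^{C(k+1,2)}`). [folklore] -/
private def symOfPairs (k : ℕ) : (Sym2 (Fin k) → ℝ) →ₗ[ℝ] Matrix (Fin k) (Fin k) ℝ where
  toFun u := Matrix.of fun i j => u s(i, j)
  map_add' u v := by ext i j; rfl
  map_smul' c u := by ext i j; rfl

/-- Every symmetric matrix is in the range of `symOfPairs`. [folklore] -/
private theorem mem_range_symOfPairs {S : Matrix (Fin k) (Fin k) ℝ} (hS : S.IsSymm) :
    S ∈ LinearMap.range (symOfPairs k) := by
  refine ⟨Sym2.lift ⟨fun i j => S i j, fun i j => hS.apply j i⟩, ?_⟩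
  ext i j
  simp [symOfPairs]

/-- `dim S^k ≤ C(k+1, 2)` in the form used here: the range of `symOfPairs` has dimension at most
`|Sym2 (Fin k)| = C(k+1,2)`. [cite: FawziEtAl2015, Prop. 2.5 (p05)] -/
private theorem finrank_range_symOfPairs_le (k : ℕ) :
    Module.finrank ℝ (LinearMap.range (symOfPairs k)) ≤ (k + 1).choose 2 := by
  calc Module.finrank ℝ (LinearMap.range (symOfPairs k))
      ≤ Module.finrank ℝ (Sym2 (Fin k) → ℝ) := LinearMap.finrank_range_le _
    _ = (k + 1).choose 2 := by
        rw [Module.finrank_fintype_fun_eq_card, Sym2.card, Fintype.card_fin]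

/-- **Symmetric factors span at most `C(k+1,2)` dimensions.** [cite: FawziEtAl2015, Prop. 2.5 (p05)] -/
theorem finrank_span_le_choose_of_isSymm (A : ι → Matrix (Fin k) (Fin k) ℝ) (hA : ∀ i, (A i).IsSymm) :
    Module.finrank ℝ (Submodule.span ℝ (Set.range A)) ≤ (k + 1).choose 2 := by
  have hle : Submodule.span ℝ (Set.range A) ≤ LinearMap.range (symOfPairs k) := by
    rw [Submodule.span_le]
    rintro _ ⟨i, rfl⟩
    exact mem_range_symOfPairs (hA i)
  exact (Submodule.finrank_mono hle).trans (finrank_range_symOfPairs_le k)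

/-- **FGPRT §7, counting dimensions** (p20: "we can count dimensions to see that … the subspace `L` is
all of `S^k`"; proof of Prop. 7.3, p21: "The set `(A_1,…,A_p)` spans `S^k` (else we could find a lower
dimensional rank factorization of `M`)"): if `M_{ij} = ⟨A_i, B_j⟩` with symmetric `k × k` matrices `A_i`
and `rank M ≥ C(k+1,2)` (so `rank M = C(k+1,2)` when the `B_j` are symmetric too, Prop. 2.5), then every
symmetric `k × k` matrix is a linear combination of the `A_i`.
[cite: FawziEtAl2015, §7 (p20) and proof of Prop. 7.3 (p21)] -/
theorem FawziEtAl2015_sec7_rowFactors_span [Fintype ι] [Fintype κ] {M : Matrix ι κ ℝ} (A : ι → Matrix (Fin k) (Fin k) ℝ)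
    (B : κ → Matrix (Fin k) (Fin k) ℝ) (hA : ∀ i, (A i).IsSymm)
    (hM : ∀ i j, M i j = (A i * B j).trace) (hr : (k + 1).choose 2 ≤ M.rank)
    {S : Matrix (Fin k) (Fin k) ℝ} (hS : S.IsSymm) : S ∈ Submodule.span ℝ (Set.range A) := by
  have hle : Submodule.span ℝ (Set.range A) ≤ LinearMap.range (symOfPairs k) := by
    rw [Submodule.span_le]
    rintro _ ⟨i, rfl⟩
    exact mem_range_symOfPairs (hA i)
  have heq : Submodule.span ℝ (Set.range A) = LinearMap.range (symOfPairs k) :=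
    Submodule.eq_of_le_of_finrank_le hle <|
      (finrank_range_symOfPairs_le k).trans (hr.trans (rank_le_finrank_span_rowFactors A B hM))
  rw [heq]
  exact mem_range_symOfPairs hS

/-- The same for the second factors: if the `B_j` are symmetric and `rank M ≥ C(k+1,2)` then the `B_j`
span `S^k`. [cite: FawziEtAl2015, §7 (p20) and proof of Prop. 7.3 (p21)] -/
theorem FawziEtAl2015_sec7_colFactors_span [Fintype ι] [Fintype κ] {M : Matrix ι κ ℝ} (A : ι → Matrix (Fin k) (Fin k) ℝ)
    (B : κ → Matrix (Fin k) (Fin k) ℝ) (hB : ∀ j, (B j).IsSymm)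
    (hM : ∀ i j, M i j = (A i * B j).trace) (hr : (k + 1).choose 2 ≤ M.rank)
    {S : Matrix (Fin k) (Fin k) ℝ} (hS : S.IsSymm) : S ∈ Submodule.span ℝ (Set.range B) :=
  FawziEtAl2015_sec7_rowFactors_span (M := Mᵀ) B A hB
    (fun j i => by rw [Matrix.transpose_apply, hM, Matrix.trace_mul_comm])
    (by rwa [Matrix.rank_transpose]) hS

/-- **Counting dimensions for psd factorizations** (the setting of Prop. 7.3: `rank M = C(k+1,2)` and a
psd factorization of size `k`): both factor families span `S^k`; in particular `M` has at least
`C(k+1,2)` rows and columns. [cite: FawziEtAl2015, §7 (p20), Prop. 7.3 (p20–p21)] -/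
theorem FawziEtAl2015_sec7_psdFactors_span [Fintype ι] [Fintype κ] {M : Matrix ι κ ℝ}
    (A : ι → Matrix (Fin k) (Fin k) ℝ) (B : κ → Matrix (Fin k) (Fin k) ℝ)
    (hA : ∀ i, (A i).PosSemidef) (hB : ∀ j, (B j).PosSemidef)
    (hM : ∀ i j, M i j = (A i * B j).trace) (hr : M.rank = (k + 1).choose 2) :
    (∀ S : Matrix (Fin k) (Fin k) ℝ, S.IsSymm → S ∈ Submodule.span ℝ (Set.range A)) ∧
    (∀ S : Matrix (Fin k) (Fin k) ℝ, S.IsSymm → S ∈ Submodule.span ℝ (Set.range B)) ∧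
    (k + 1).choose 2 ≤ Fintype.card ι ∧ (k + 1).choose 2 ≤ Fintype.card κ := by
  have hAs : ∀ i, (A i).IsSymm := fun i => by
    have := (hA i).1; rwa [Matrix.IsHermitian, Matrix.conjTranspose_eq_transpose_of_trivial] at this
  have hBs : ∀ j, (B j).IsSymm := fun j => by
    have := (hB j).1; rwa [Matrix.IsHermitian, Matrix.conjTranspose_eq_transpose_of_trivial] at this
  refine ⟨fun S hS => FawziEtAl2015_sec7_rowFactors_span A B hAs hM hr.ge hS,
    fun S hS => FawziEtAl2015_sec7_colFactors_span A B hBs hM hr.ge hS, ?_, ?_⟩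
  · calc (k + 1).choose 2 = M.rank := hr.symm
      _ ≤ Fintype.card ι := Matrix.rank_le_card_height M
  · calc (k + 1).choose 2 = M.rank := hr.symm
      _ ≤ Fintype.card κ := Matrix.rank_le_card_width M

end CountDimensions

/-- **Example 7.7 counts dimensions**: `rank M = 3 = C(3,2)` for the matrix of Example 7.7, so the four
displayed factors `A_1,…,A_4` (and likewise `B_1,…,B_4`) span `S^2`.
[cite: FawziEtAl2015, Ex. 7.7 (p21–p22) with Prop. 7.3 (p20)] -/
theorem FawziEtAl2015_ex77_factors_span :
    (∀ S : Matrix (Fin 2) (Fin 2) ℝ, S.IsSymm → S ∈ Submodule.span ℝ (Set.range ex77RowFactor)) ∧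
    (∀ S : Matrix (Fin 2) (Fin 2) ℝ, S.IsSymm → S ∈ Submodule.span ℝ (Set.range ex77ColFactor)) := by
  have hM := FawziEtAl2015_ex77.1
  have hr : (2 + 1).choose 2 ≤ ex77Matrix.rank := by rw [rank_ex77Matrix]; decide
  have hA : ∀ i, (ex77RowFactor i).IsSymm := by
    intro i
    fin_cases i <;> exact Matrix.IsSymm.ext fun a b => by fin_cases a <;> fin_cases b <;> rfl
  have hB : ∀ j, (ex77ColFactor j).IsSymm := by
    intro j
    fin_cases j <;> exact Matrix.IsSymm.ext fun a b => by fin_cases a <;> fin_cases b <;> rfl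
  exact ⟨fun S hS => FawziEtAl2015_sec7_rowFactors_span _ _ hA hM hr hS,
    fun S hS => FawziEtAl2015_sec7_colFactors_span _ _ hB hM hr hS⟩

/-! ### Proposition 7.3 (p20–p21): the two constructions `𝒮ℱ(M) ⇄ Δ_k(P,Q)` -/

section Prop73

variable {ι κ : Type*} {k r : ℕ}

/-- **`Δ_k(P,Q)`** (p20): for a rank factorization `M = U V` with `u_i` the rows of `U` and `v_j` the
columns of `V`, `P = cone(u_1,…,u_p)` and `Q = {x | v_jᵀ x ≥ 0 for all j}`; "`Δ_k(P,Q)` [is] the space of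
all linear maps `π : S^k → ℝ^{C(k+1,2)}` such that `P ⊂ π(S^k_+) ⊂ Q`". Typed for a linear map `π`
defined on all `k × k` matrices (only its values on `S^k` matter) with target `ℝ^r`: every generator
`u_i` is the image of a psd matrix (equivalently `P ⊆ π(S^k_+)`, `IsNestedConeMap.cone_subset`), and
`v_jᵀ π(L) ≥ 0` for every psd `L`. [cite: FawziEtAl2015, §7 (p20), Def. 7.2 (p20)] -/
def IsNestedConeMap (U : Matrix ι (Fin r) ℝ) (V : Matrix (Fin r) κ ℝ) (k : ℕ)
    (π : Matrix (Fin k) (Fin k) ℝ →ₗ[ℝ] (Fin r → ℝ)) : Prop :=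
  (∀ i, ∃ L : Matrix (Fin k) (Fin k) ℝ, L.PosSemidef ∧ π L = U i) ∧
    ∀ L : Matrix (Fin k) (Fin k) ℝ, L.PosSemidef → ∀ j, 0 ≤ (π L ᵥ* V) j

/-- `P = cone(u_i) ⊆ π(S^k_+)`: every nonnegative combination of the `u_i` is the image of a psd
matrix (the psd cone is a convex cone). [cite: FawziEtAl2015, §7 (p20)] -/
theorem IsNestedConeMap.cone_subset [Fintype ι] {U : Matrix ι (Fin r) ℝ} {V : Matrix (Fin r) κ ℝ}
    {π : Matrix (Fin k) (Fin k) ℝ →ₗ[ℝ] (Fin r → ℝ)} (hπ : IsNestedConeMap U V k π)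
    (c : ι → ℝ) (hc : ∀ i, 0 ≤ c i) :
    ∃ L : Matrix (Fin k) (Fin k) ℝ, L.PosSemidef ∧ π L = ∑ i, c i • U i := by
  choose L hL hπL using hπ.1
  refine ⟨∑ i, c i • L i, ?_, ?_⟩
  · exact posSemidef_sum _ fun i _ => (hL i).smul (hc i)
  · simp [map_sum, map_smul, hπL]

/-- `Tr(A B) ≥ 0` for psd `A, B` (p05: "The inner product of any two psd matrices is nonnegative").
[cite: FawziEtAl2015, §2 (p05)] -/
private theorem trace_mul_nonneg_sf {A B : Matrix (Fin k) (Fin k) ℝ} (hA : A.PosSemidef)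
    (hB : B.PosSemidef) : 0 ≤ (A * B).trace :=
  HasPsdFactorization.nonneg (M := fun _ _ : Unit => (A * B).trace)
    ⟨fun _ => A, fun _ => B, fun _ => hA, fun _ => hB, fun _ _ => rfl⟩ () ()

/-- A real psd matrix is symmetric. [folklore] -/
private theorem isSymm_of_posSemidef_sf {A : Matrix (Fin k) (Fin k) ℝ} (hA : A.PosSemidef) :
    A.IsSymm := by
  have := hA.1
  rwa [Matrix.IsHermitian, Matrix.conjTranspose_eq_transpose_of_trivial] at this

/-- For symmetric `B_j`, `X ↦ (⟨X,B_j⟩)_j` does not see the antisymmetric part: `T(Xᵀ) = T(X)`.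
[folklore] -/
private theorem traceRowMap_transpose {B : κ → Matrix (Fin k) (Fin k) ℝ} (hB : ∀ j, (B j).IsSymm)
    (X : Matrix (Fin k) (Fin k) ℝ) : traceRowMap B Xᵀ = traceRowMap B X := by
  ext j
  change (Xᵀ * B j).trace = (X * B j).trace
  rw [← Matrix.trace_transpose (X * B j), Matrix.transpose_mul, (hB j).eq, Matrix.trace_mul_comm]

/-- In a rank factorization `M = U V` with `r = rank M` inner dimension, `V` has full row rank:
`x ↦ xᵀV` is injective. [folklore] -/
private theorem vecMul_injective_of_rank_eq [Fintype κ] {M : Matrix ι κ ℝ} {U : Matrix ι (Fin r) ℝ}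
    {V : Matrix (Fin r) κ ℝ} (hUV : M = U * V) (hr : M.rank = r) : Function.Injective V.vecMul := by
  have h2 : r ≤ V.rank := by
    calc r = M.rank := hr.symm
      _ = (U * V).rank := by rw [hUV]
      _ ≤ V.rank := Matrix.rank_mul_le_right U V
  have hVrank : V.rank = r :=
    le_antisymm ((Matrix.rank_le_card_height V).trans (Fintype.card_fin r).le) h2
  rw [Matrix.vecMul_injective_iff, linearIndependent_iff_card_eq_finrank_span, Fintype.card_fin,
    Set.finrank, ← Matrix.rank_eq_finrank_span_row, hVrank]

/-- In a rank factorization `M = U V` with `r = rank M` inner dimension, `U` has full column rank: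
its rows span `ℝ^r`. [folklore] -/
private theorem span_rows_eq_top_of_rank_eq [Fintype ι] [Fintype κ] {M : Matrix ι κ ℝ} {U : Matrix ι (Fin r) ℝ}
    {V : Matrix (Fin r) κ ℝ} (hUV : M = U * V) (hr : M.rank = r) :
    Submodule.span ℝ (Set.range U.row) = ⊤ := by
  have h2 : r ≤ U.rank := by
    calc r = M.rank := hr.symm
      _ = (U * V).rank := by rw [hUV]
      _ ≤ U.rank := Matrix.rank_mul_le_left U V
  have hUrank : U.rank = r :=
    le_antisymm ((Matrix.rank_le_card_width U).trans (Fintype.card_fin r).le) h2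
  apply Submodule.eq_top_of_finrank_eq
  rw [← Matrix.rank_eq_finrank_span_row, hUrank, Module.finrank_fintype_fun_eq_card, Fintype.card_fin]

/-- **FGPRT Proposition 7.3, the map `𝒮ℱ(M) → Δ_k(P,Q)`** (p21, verbatim): "Suppose `(A_1,…,B_q)` is a
psd factorization of `M`. The set `(A_1,…,A_p)` spans `S^k` …, so we can define a linear map `π` by
making `π(A_i) = u_i`. This map is well-defined since … `V` has full row rank … By the definition of `π`,
it is immediate that `P ⊂ π(S^k_+)`. Since `π` has the property that `⟨π(L), v_j⟩ = ⟨L, B_j⟩` for each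
`j`, we also have that `π(S^k_+) ⊂ Q`. Thus, we have defined a map from `𝒮ℱ(M)` to `Δ_k(P,Q)`." Typed:
for `M = U V` with inner dimension `r = rank M = C(k+1,2)` and `(A,B) ∈ 𝒮ℱ(M)` of size `k`, there is a
linear `π` (on all `k × k` matrices) with `π(A_i) = u_i`, `π(L)ᵀ V = (⟨L,B_j⟩)_j` for every `L`, and
`π ∈ Δ_k(P,Q)`. (Construction: `π = g ∘ T`, `T(L) = (⟨L,B_j⟩)_j` lands in the row space of `V` because
`L + Lᵀ ∈ S^k = span{A_i}` and `T(A_i) = M_i = u_iᵀ V`, and `g` is a left inverse of `x ↦ xᵀV`.)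
[cite: FawziEtAl2015, Prop. 7.3 (p20–p21)] -/
theorem FawziEtAl2015_prop73_forward [Fintype ι] [Fintype κ] {M : Matrix ι κ ℝ} {U : Matrix ι (Fin r) ℝ}
    {V : Matrix (Fin r) κ ℝ} (hUV : M = U * V) (hr : M.rank = r) (hk : r = (k + 1).choose 2)
    {A : ι → Matrix (Fin k) (Fin k) ℝ} {B : κ → Matrix (Fin k) (Fin k) ℝ}
    (h : (A, B) ∈ psdFactorizationSpace M k) :
    ∃ π : Matrix (Fin k) (Fin k) ℝ →ₗ[ℝ] (Fin r → ℝ),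
      (∀ i, π (A i) = U i) ∧ (∀ L, π L ᵥ* V = fun j => (L * B j).trace) ∧ IsNestedConeMap U V k π := by
  classical
  obtain ⟨hA, hB, hM⟩ := h
  have hAs : ∀ i, (A i).IsSymm := fun i => isSymm_of_posSemidef_sf (hA i)
  have hBs : ∀ j, (B j).IsSymm := fun j => isSymm_of_posSemidef_sf (hB j)
  -- `V` has full row rank: a left inverse `g` of `x ↦ xᵀ V`
  have hker : LinearMap.ker V.vecMulLinear = ⊥ :=
    LinearMap.ker_eq_bot.mpr (vecMul_injective_of_rank_eq hUV hr)
  obtain ⟨g, hg⟩ := LinearMap.exists_leftInverse_of_injective V.vecMulLinear hker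
  have hg' : ∀ y, g (y ᵥ* V) = y := fun y => by
    simpa using congrArg (fun f => f y) hg
  -- `T(A_i) = M_i = u_iᵀ V`
  have hTA : ∀ i, traceRowMap B (A i) = U i ᵥ* V := by
    intro i
    ext j
    change (A i * B j).trace = (U i ᵥ* V) j
    rw [← hM, hUV, Matrix.mul_apply]
    rfl
  -- `T(L)` lies in the row space of `V` for every `L`
  have hr' : (k + 1).choose 2 ≤ M.rank := by rw [hr, hk]
  have hrange : ∀ L, ∃ y : Fin r → ℝ, y ᵥ* V = traceRowMap B L := by
    intro L
    have hsym : (L + Lᵀ).IsSymm := by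
      rw [Matrix.IsSymm, Matrix.transpose_add, Matrix.transpose_transpose, add_comm]
    have hmem := FawziEtAl2015_sec7_rowFactors_span A B hAs hM hr' hsym
    have hle : Submodule.span ℝ (Set.range A) ≤
        (LinearMap.range V.vecMulLinear).comap (traceRowMap B) := by
      rw [Submodule.span_le]
      rintro _ ⟨i, rfl⟩
      exact ⟨U i, by simp [hTA i]⟩
    obtain ⟨y, hy⟩ := hle hmem
    refine ⟨(1 / 2 : ℝ) • y, ?_⟩
    have h2 : traceRowMap B (L + Lᵀ) = (2 : ℝ) • traceRowMap B L := by
      rw [map_add, traceRowMap_transpose hBs, two_smul]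
    rw [Matrix.smul_vecMul, show y ᵥ* V = traceRowMap B (L + Lᵀ) from hy, h2, smul_smul]
    norm_num
  refine ⟨g.comp (traceRowMap B), fun i => ?_, fun L => ?_, fun i => ?_, fun L hL j => ?_⟩
  · rw [LinearMap.comp_apply, hTA, hg']
  · obtain ⟨y, hy⟩ := hrange L
    rw [LinearMap.comp_apply, ← hy, hg', hy]
    rfl
  · exact ⟨A i, hA i, by rw [LinearMap.comp_apply, hTA, hg']⟩
  · obtain ⟨y, hy⟩ := hrange L
    rw [LinearMap.comp_apply, ← hy, hg', hy]
    exact trace_mul_nonneg_sf hL (hB j)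

/-- "`Δ_k(P,Q)` is nonempty with `M`, `P`, and `Q` as above" (p20): a psd factorization of size `k` of
`M = U V` (`rank M = r = C(k+1,2)`) yields an element of `Δ_k(P,Q)`. [cite: FawziEtAl2015, §7 (p20)] -/
theorem FawziEtAl2015_sec7_delta_nonempty [Fintype ι] [Fintype κ] {M : Matrix ι κ ℝ} {U : Matrix ι (Fin r) ℝ}
    {V : Matrix (Fin r) κ ℝ} (hUV : M = U * V) (hr : M.rank = r) (hk : r = (k + 1).choose 2)
    (hM : HasPsdFactorization M k) :
    ∃ π : Matrix (Fin k) (Fin k) ℝ →ₗ[ℝ] (Fin r → ℝ), IsNestedConeMap U V k π := by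
  obtain ⟨⟨A, B⟩, h⟩ := psdFactorizationSpace_nonempty_iff.mpr hM
  obtain ⟨π, -, -, hπ⟩ := FawziEtAl2015_prop73_forward hUV hr hk h
  exact ⟨π, hπ⟩

/-- **Well-definedness** (p21: "This map is well-defined since …"): any two linear maps sending
`A_i ↦ u_i` agree on `S^k`, because the `A_i` span `S^k`. [cite: FawziEtAl2015, Prop. 7.3 (p21)] -/
theorem FawziEtAl2015_prop73_unique [Fintype ι] [Fintype κ] {M : Matrix ι κ ℝ} {U : Matrix ι (Fin r) ℝ}
    (hr : M.rank = r) (hk : r = (k + 1).choose 2)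
    {A : ι → Matrix (Fin k) (Fin k) ℝ} {B : κ → Matrix (Fin k) (Fin k) ℝ}
    (h : (A, B) ∈ psdFactorizationSpace M k)
    {π π' : Matrix (Fin k) (Fin k) ℝ →ₗ[ℝ] (Fin r → ℝ)} (hπ : ∀ i, π (A i) = U i)
    (hπ' : ∀ i, π' (A i) = U i) {L : Matrix (Fin k) (Fin k) ℝ} (hL : L.IsSymm) : π L = π' L := by
  have hAs : ∀ i, (A i).IsSymm := fun i => isSymm_of_posSemidef_sf (h.1 i)
  have hr' : (k + 1).choose 2 ≤ M.rank := by rw [hr, hk]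
  have hmem := FawziEtAl2015_sec7_rowFactors_span A B hAs h.2.2 hr' hL
  refine LinearMap.eqOn_span' (s := Set.range A) ?_ hmem
  rintro _ ⟨i, rfl⟩
  rw [hπ, hπ']

/-- The adjoint representative: the symmetric matrix `B` with `⟨L, B⟩ = φ(L)` for all symmetric `L`
(`B_{st} = ½(φ(E_{st}) + φ(E_{ts}))`). [folklore] -/
private def adjOf (φ : Matrix (Fin k) (Fin k) ℝ →ₗ[ℝ] ℝ) : Matrix (Fin k) (Fin k) ℝ :=
  Matrix.of fun s t => (φ (Matrix.single s t 1) + φ (Matrix.single t s 1)) / 2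

/-- The adjoint representative is symmetric. [folklore] -/
private theorem adjOf_isSymm (φ : Matrix (Fin k) (Fin k) ℝ →ₗ[ℝ] ℝ) : (adjOf φ).IsSymm := by
  refine Matrix.IsSymm.ext fun s t => ?_
  simp only [adjOf, Matrix.of_apply]
  rw [add_comm]

/-- `⟨L, adjOf φ⟩ = φ(L)` for symmetric `L`. [folklore] -/
private theorem trace_mul_adjOf (φ : Matrix (Fin k) (Fin k) ℝ →ₗ[ℝ] ℝ) {L : Matrix (Fin k) (Fin k) ℝ}
    (hL : L.IsSymm) : (L * adjOf φ).trace = φ L := by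
  have hφ : φ L = ∑ s, ∑ t, L s t * φ (Matrix.single s t 1) := by
    conv_lhs => rw [Matrix.matrix_eq_sum_single L]
    simp only [map_sum]
    refine sum_congr rfl fun s _ => sum_congr rfl fun t _ => ?_
    rw [show Matrix.single s t (L s t) = L s t • Matrix.single s t (1 : ℝ) by
      rw [Matrix.smul_single, smul_eq_mul, mul_one], map_smul, smul_eq_mul]
  have hsym : ∑ s, ∑ t, L s t * φ (Matrix.single t s 1) = ∑ s, ∑ t, L s t * φ (Matrix.single s t 1) := by
    rw [Finset.sum_comm]
    exact sum_congr rfl fun s _ => sum_congr rfl fun t _ => by rw [hL.apply t s]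
  have hentry : ∀ s t, L s t * adjOf φ t s =
      (L s t * φ (Matrix.single t s 1) + L s t * φ (Matrix.single s t 1)) / 2 := by
    intro s t
    simp only [adjOf, Matrix.of_apply]
    ring
  simp only [Matrix.trace, Matrix.diag_apply, Matrix.mul_apply, hentry, ← Finset.sum_div,
    Finset.sum_add_distrib, hsym, hφ]
  ring

/-- `xᵀ B x = ⟨x xᵀ, B⟩`. [folklore] -/
private theorem dotProduct_mulVec_eq_trace_vecMulVec (x : Fin k → ℝ) (B : Matrix (Fin k) (Fin k) ℝ) :
    x ⬝ᵥ (B *ᵥ x) = (Matrix.vecMulVec x x * B).trace := by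
  simp only [dotProduct, Matrix.mulVec, Matrix.trace, Matrix.diag_apply, Matrix.mul_apply,
    Matrix.vecMulVec_apply, Finset.mul_sum]
  rw [Finset.sum_comm]
  exact sum_congr rfl fun s _ => sum_congr rfl fun t _ => by ring

/-- **FGPRT Proposition 7.3, the map `Δ_k(P,Q) → 𝒮ℱ(M)`** (p21, verbatim): "Next, suppose that we have
`π ∈ Δ_k(P,Q)`. Define `A_i = π⁻¹(u_i)` and `B_j = π^*(v_j)` where `π^*` is the adjoint map. Then
`A_i ∈ S^k_+` and `B_j ∈ (S^k_+)^* = S^k_+` and these matrices form a psd factorization of `M`." Typed: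
for `M = U V` and `π ∈ Δ_k(P,Q)` there is `(A,B) ∈ 𝒮ℱ(M)` of size `k` with `π(A_i) = u_i` and
`⟨L, B_j⟩ = v_jᵀ π(L)` for all symmetric `L` (`B_j` the adjoint representative on `S^k`; it is psd
because `xᵀ B_j x = v_jᵀ π(x xᵀ) ≥ 0`). No rank hypothesis is needed for this direction.
[cite: FawziEtAl2015, Prop. 7.3 (p20–p21)] -/
theorem FawziEtAl2015_prop73_backward {M : Matrix ι κ ℝ} {U : Matrix ι (Fin r) ℝ}
    {V : Matrix (Fin r) κ ℝ} (hUV : M = U * V) {π : Matrix (Fin k) (Fin k) ℝ →ₗ[ℝ] (Fin r → ℝ)}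
    (hπ : IsNestedConeMap U V k π) :
    ∃ (A : ι → Matrix (Fin k) (Fin k) ℝ) (B : κ → Matrix (Fin k) (Fin k) ℝ),
      (A, B) ∈ psdFactorizationSpace M k ∧ (∀ i, π (A i) = U i) ∧
      ∀ j (L : Matrix (Fin k) (Fin k) ℝ), L.IsSymm → (L * B j).trace = (π L ᵥ* V) j := by
  classical
  choose A hA hπA using hπ.1
  -- `φ_j(L) = v_jᵀ π(L)` and its adjoint representative `B_j`
  let φ : κ → (Matrix (Fin k) (Fin k) ℝ →ₗ[ℝ] ℝ) :=
    fun j => (LinearMap.proj j).comp (V.vecMulLinear.comp π)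
  have hφ : ∀ j L, φ j L = (π L ᵥ* V) j := fun j L => rfl
  refine ⟨A, fun j => adjOf (φ j), ⟨hA, fun j => ?_, fun i j => ?_⟩, hπA, fun j L hL => ?_⟩
  · -- `B_j` is psd: symmetric, and `xᵀ B_j x = φ_j(x xᵀ) ≥ 0`
    refine PosSemidef.of_dotProduct_mulVec_nonneg ?_ fun x => ?_
    · rw [Matrix.IsHermitian, Matrix.conjTranspose_eq_transpose_of_trivial]
      exact (adjOf_isSymm (φ j)).eq
    · have hxx : (Matrix.vecMulVec x x).PosSemidef := by
        simpa using Matrix.posSemidef_vecMulVec_self_star x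
      have hxs : (Matrix.vecMulVec x x).IsSymm := isSymm_of_posSemidef_sf hxx
      rw [star_trivial, dotProduct_mulVec_eq_trace_vecMulVec, trace_mul_adjOf (φ j) hxs, hφ]
      exact hπ.2 _ hxx j
  · -- `M_{ij} = u_iᵀ v_j = v_jᵀ π(A_i) = ⟨A_i, B_j⟩`
    change M i j = (A i * adjOf (φ j)).trace
    rw [trace_mul_adjOf (φ j) (isSymm_of_posSemidef_sf (hA i)), hφ, hπA, hUV, Matrix.mul_apply]
    rfl
  · rw [trace_mul_adjOf (φ j) hL, hφ]

/-- **FGPRT Proposition 7.3, "This map is the inverse of the one defined above"** (p21): going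
`𝒮ℱ(M) → Δ_k(P,Q) → 𝒮ℱ(M)` returns the factorization one started from. Typed: let `M = U V` with
`r = rank M = C(k+1,2)`, `(A,B) ∈ 𝒮ℱ(M)`, and `π` linear with `π(A_i) = u_i` and
`π(L)ᵀ V = (⟨L,B_j⟩)_j` on `S^k` (the forward image); if `(A',B') ∈ 𝒮ℱ(M)` has `π(A'_i) = u_i` and
`⟨L,B'_j⟩ = v_jᵀ π(L)` on `S^k` (the backward image of `π`), then `A' = A` and `B' = B` — `π` is
injective on `S^k` by counting dimensions (`π(S^k) ⊇ span{u_i} = ℝ^r`, `dim S^k ≤ C(k+1,2) = r`), and a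
symmetric matrix is determined by its pairings with `S^k`. [cite: FawziEtAl2015, Prop. 7.3 (p21)] -/
theorem FawziEtAl2015_prop73_inverse [Fintype ι] [Fintype κ] {M : Matrix ι κ ℝ} {U : Matrix ι (Fin r) ℝ}
    {V : Matrix (Fin r) κ ℝ} (hUV : M = U * V) (hr : M.rank = r) (hk : r = (k + 1).choose 2)
    {A A' : ι → Matrix (Fin k) (Fin k) ℝ} {B B' : κ → Matrix (Fin k) (Fin k) ℝ}
    (h : (A, B) ∈ psdFactorizationSpace M k) (h' : (A', B') ∈ psdFactorizationSpace M k)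
    {π : Matrix (Fin k) (Fin k) ℝ →ₗ[ℝ] (Fin r → ℝ)} (hπA : ∀ i, π (A i) = U i)
    (hπB : ∀ L : Matrix (Fin k) (Fin k) ℝ, L.IsSymm → π L ᵥ* V = fun j => (L * B j).trace)
    (hπA' : ∀ i, π (A' i) = U i)
    (hπB' : ∀ j (L : Matrix (Fin k) (Fin k) ℝ), L.IsSymm → (L * B' j).trace = (π L ᵥ* V) j) :
    A' = A ∧ B' = B := by
  classical
  have hAs : ∀ i, (A i).IsSymm := fun i => isSymm_of_posSemidef_sf (h.1 i)
  have hA's : ∀ i, (A' i).IsSymm := fun i => isSymm_of_posSemidef_sf (h'.1 i)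
  have hBs : ∀ j, (B j).IsSymm := fun j => isSymm_of_posSemidef_sf (h.2.1 j)
  have hB's : ∀ j, (B' j).IsSymm := fun j => isSymm_of_posSemidef_sf (h'.2.1 j)
  have hr' : (k + 1).choose 2 ≤ M.rank := by rw [hr, hk]
  -- `W = span{A_i} ⊇ S^k`, and `π|_W` is injective by counting dimensions
  set W := Submodule.span ℝ (Set.range A) with hW
  have hWsymm : ∀ S : Matrix (Fin k) (Fin k) ℝ, S.IsSymm → S ∈ W := fun S hS =>
    FawziEtAl2015_sec7_rowFactors_span A B hAs h.2.2 hr' hS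
  have hWtop : W.map π = ⊤ := by
    rw [hW, Submodule.map_span, ← span_rows_eq_top_of_rank_eq hUV hr]
    congr 1
    ext x
    constructor
    · rintro ⟨_, ⟨i, rfl⟩, rfl⟩; exact ⟨i, (hπA i).symm⟩
    · rintro ⟨i, rfl⟩; exact ⟨A i, ⟨i, rfl⟩, hπA i⟩
  have hWfin : Module.finrank ℝ W = r := by
    refine le_antisymm (hk ▸ finrank_span_le_choose_of_isSymm A hAs) ?_
    have h1 : Module.finrank ℝ (W.map π) ≤ Module.finrank ℝ W := Submodule.finrank_map_le π W
    rw [hWtop, finrank_top, Module.finrank_fintype_fun_eq_card, Fintype.card_fin] at h1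
    exact h1
  have hinj : ∀ S ∈ W, π S = 0 → S = 0 := by
    have hsurj : Function.Surjective (π.domRestrict W) := by
      rw [← LinearMap.range_eq_top, LinearMap.range_domRestrict, hWtop]
    have hinj' : Function.Injective (π.domRestrict W) :=
      (LinearMap.injective_iff_surjective_of_finrank_eq_finrank
        (by rw [hWfin, Module.finrank_fintype_fun_eq_card, Fintype.card_fin])).mpr hsurj
    intro S hS hS0
    have : (⟨S, hS⟩ : W) = 0 := hinj' (by simpa using hS0)
    simpa using congrArg Subtype.val this
  refine ⟨funext fun i => ?_, funext fun j => ?_⟩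
  · -- `π(A'_i − A_i) = 0` with `A'_i − A_i ∈ S^k ⊆ W`
    have hmem : A' i - A i ∈ W := hWsymm _ (by
      rw [Matrix.IsSymm, Matrix.transpose_sub, (hA's i).eq, (hAs i).eq])
    exact sub_eq_zero.mp (hinj _ hmem (by rw [map_sub, hπA, hπA', sub_self]))
  · -- `⟨L, B'_j − B_j⟩ = 0` for all symmetric `L`; take `L = B'_j − B_j`
    have hzero : ∀ L : Matrix (Fin k) (Fin k) ℝ, L.IsSymm → (L * (B' j - B j)).trace = 0 := by
      intro L hL
      rw [Matrix.mul_sub, Matrix.trace_sub, hπB' j L hL, hπB L hL, sub_self]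
    have hDs : (B' j - B j).IsSymm := by
      rw [Matrix.IsSymm, Matrix.transpose_sub, (hB's j).eq, (hBs j).eq]
    have h0 : ((B' j - B j)ᴴ * (B' j - B j)).trace = 0 := by
      rw [Matrix.conjTranspose_eq_transpose_of_trivial, hDs.eq]
      exact hzero _ hDs
    exact sub_eq_zero.mp (Matrix.trace_conjTranspose_mul_self_eq_zero_iff.mp h0)

end Prop73

end Literature.Combinatorics.Optimization
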